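import Literature.Computability.AlgebraicComplexity.FlipGraphStandardNeighbour
import HarnessLib

/-!
# The flips of the standard algorithm over an arbitrary field, and its irreducibility (KM 2023 §4)

Topic `Literature/Computability/AlgebraicComplexity`, over the flip-graph vocabulary of
`FlipGraphConnectivity.lean` (KM Def. 1 `Scheme`, Def. 4 `FlipBase`/`Flips`, Prop. 3
`RedBase`/`Reduces`, Def. 8 `Adj`, `stdScheme`), `FlipGraphLadermanIsolatedKM.lean` (`fam`) and
`FlipGraphStandardNeighbour.lean` (the `ℤ₂` case). Source: M. Kauers, J. Moosbauer, *Flip Graphs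
for Matrix Multiplication*, ISSAC 2023 = arXiv:2212.01175 (KM), §4: "Although the standard
algorithm allows many flips, it only has one neighbor, because any two schemes obtained by a flip
from the standard algorithm are equivalent" and "None of them is reducible" (the schemes near the
standard algorithm). This file removes the restriction to `ℤ₂` in the DESCRIPTION of the flips of
the standard algorithm and in its irreducibility: everything here holds for `⟨n,n,n⟩` over an
arbitrary field and every `n`. Everything is PROVED; no named facts.

## What is typed

* `exists_smul_of_triad_eq` — over a field the factors of a non-zero rank-one tensor are determined
  up to scalars `α, β, γ` with `αβγ = 1` (KM Def. 1: "rank-one tensors are the non-zero tensors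
  `A⊗B⊗Γ`"; over `ℤ₂` this is `triad_factors_eq_of_two`).
* `StdFlips.exists_normalForm_of_flipBase` — **every flip of the standard algorithm of `⟨n,n,n⟩`
  in the written case of Def. 4 (shared `Z`-factor) is a normal form** `N(p, q, c)`: for two
  products `p = (κ,μ,ν) ≠ q = (κ,μ',ν)` with the same `Z`-factor and a scalar `c ≠ 0`, the standard
  algorithm with `E_p, E_q` replaced by `E_p + c·D`, `E_q − c·D`, `D = e_{κν} ⊗ e_{κμ} ⊗ e_{μ'ν}`
  (both choices of `T` in Def. 4 and all admissible presentations `A⊗B⊗Γ` of the two elements —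
  which over a general field carry free scalars — land in this one-parameter family);
  `StdFlips.flipBase_normalForm` — conversely every `N(p, q, c)`, `c ≠ 0`, IS such a flip.
* `not_redBase_fam_of_sep'` — a field version of the `ℤ₂` irreducibility criterion of
  `FlipGraphStandardNeighbour.lean` (line factors up to scalars), and
  **`StdFlips.not_reduces_std`**: the standard algorithm of `⟨n,n,n⟩` is irreducible (no `E₂` edge
  leaves it) over every field — KM §4 "None of them is reducible" for the standard algorithm
  itself; hence every neighbour of the standard algorithm is a flip (`StdFlips.flips_of_adj_std`).

* §4: **all flips of the standard algorithm are `G`-equivalent, for every field and every `n`**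
  (`StdFlips.std_neighbours_equivalent`, `kauersMoosbauer2023_std_neighbours_equivalent`; in KM's
  flip graph on orbits the standard algorithm has at most one out-neighbour,
  `StdFlips.std_one_neighbour`) — KM §4 "it only has one neighbor, because any two schemes
  obtained by a flip from the standard algorithm are equivalent", by explicit group elements: a
  diagonal sandwich rescales `c` to `1` (`StdFlips.exists_map_normalForm_eq_one`), a permutation
  sandwich matches any two flipped pairs (`StdFlips.map_normalForm_relabelSym`,
  `StdFlips.exists_idxRelabel`), the cyclic shift carries `Z`-flips to `Y`- and `X`-flips
  (`StdFlips.map_normalForm_cycleSq`, `StdFlips.map_normalForm₃_cycleSq`). (The `ℤ₂`, `n ≤ 3`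
  case by enumeration is `FlipGraphStandardNeighbour.lean`.)
* §5: the neighbour EXISTS iff `n ≥ 2` (`StdFlips.nfScheme`, `StdFlips.exists_adj_std`,
  `StdFlips.not_adj_std_of_le_one`): **for `n ≥ 2` the standard algorithm has exactly one neighbour**
  (`StdFlips.std_existsUnique_neighbour`, `kauersMoosbauer2023_std_existsUnique_neighbour`), for
  `n ≤ 1` none (`StdFlips.std_no_neighbour_of_le_one`).

## References

* M. Kauers, J. Moosbauer, *Flip Graphs for Matrix Multiplication*, ISSAC 2023, 381–388,
  doi:10.1145/3597066.3597120, arXiv:2212.01175: Def. 1, Def. 2, Prop. 3, Def. 4, §4 (the standard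
  algorithm's neighbours; "None of them is reducible"). [KauersMoosbauer2022FlipGraphs]
-/

namespace Literature.Computability.AlgebraicComplexity

open scoped BigOperators
open Multiset

namespace FlipGraph

/-! ## §1 Over a field the factors of a non-zero rank-one tensor are determined up to scalars -/

section Rigidity

variable {K : Type*} [Field K] {ι κ μ : Type*}

/-- **Rigidity of rank-one tensors over a field:** if `a⊗b⊗c = a'⊗b'⊗c' ≠ 0` then `a = α a'`,
`b = β b'`, `c = γ c'` with `α β γ = 1` (KM Def. 1: rank-one tensors are the non-zero `A⊗B⊗Γ`; the
presentation is unique up to such scalars). [cite: KauersMoosbauer2022FlipGraphs, Def. 1] -/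
theorem exists_smul_of_triad_eq {a a' : ι → K} {b b' : κ → K} {c c' : μ → K}
    (h : triad a b c = triad a' b' c') (h0 : triad a b c ≠ 0) :
    ∃ α β γ : K, a = α • a' ∧ b = β • b' ∧ c = γ • c' ∧ α * β * γ = 1 := by
  have key : ∀ x y z, a x * b y * c z = a' x * b' y * c' z := fun x y z => by
    have e := congrFun (congrFun (congrFun h x) y) z
    simpa only [triad_apply] using e
  -- a point where the tensor does not vanish
  have hex : ∃ x y z, a x * b y * c z ≠ 0 := by
    by_contra hne
    push Not at hne
    exact h0 (funext fun x => funext fun y => funext fun z => by simpa [triad_apply] using hne x y z)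
  obtain ⟨x₀, y₀, z₀, hP⟩ := hex
  have ha : a x₀ ≠ 0 := fun e => hP (by rw [e, zero_mul, zero_mul])
  have hb : b y₀ ≠ 0 := fun e => hP (by rw [e, mul_zero, zero_mul])
  have hc : c z₀ ≠ 0 := fun e => hP (by rw [e, mul_zero])
  have hP' : a' x₀ * b' y₀ * c' z₀ ≠ 0 := by rw [← key]; exact hP
  have ha' : a' x₀ ≠ 0 := fun e => hP' (by rw [e, zero_mul, zero_mul])
  have hb' : b' y₀ ≠ 0 := fun e => hP' (by rw [e, mul_zero, zero_mul])
  have hc' : c' z₀ ≠ 0 := fun e => hP' (by rw [e, mul_zero])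
  refine ⟨(b' y₀ * c' z₀) / (b y₀ * c z₀), (a' x₀ * c' z₀) / (a x₀ * c z₀),
    (a' x₀ * b' y₀) / (a x₀ * b y₀), ?_, ?_, ?_, ?_⟩
  · funext x
    have e := key x y₀ z₀
    rw [Pi.smul_apply, smul_eq_mul]
    field_simp
    linear_combination e
  · funext y
    have e := key x₀ y z₀
    rw [Pi.smul_apply, smul_eq_mul]
    field_simp
    linear_combination e
  · funext z
    have e := key x₀ y₀ z
    rw [Pi.smul_apply, smul_eq_mul]
    field_simp
    linear_combination e
  · have e := key x₀ y₀ z₀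
    have hden : b y₀ * c z₀ * (a x₀ * c z₀) * (a x₀ * b y₀) ≠ 0 :=
      mul_ne_zero (mul_ne_zero (mul_ne_zero hb hc) (mul_ne_zero ha hc)) (mul_ne_zero ha hb)
    rw [div_mul_div_comm, div_mul_div_comm, div_eq_one_iff_eq hden]
    calc b' y₀ * c' z₀ * (a' x₀ * c' z₀) * (a' x₀ * b' y₀)
        = (a' x₀ * b' y₀ * c' z₀) ^ 2 := by ring
      _ = (a x₀ * b y₀ * c z₀) ^ 2 := by rw [e]
      _ = b y₀ * c z₀ * (a x₀ * c z₀) * (a x₀ * b y₀) := by ring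

/-- Scalars on the three factors collect: `(αa)⊗(βb)⊗(γc) = (αβγ)·(a⊗b⊗c)`. [folklore] -/
private theorem triad_smul₃ (α β γ : K) (a : ι → K) (b : κ → K) (c : μ → K) :
    triad (α • a) (β • b) (γ • c) = (α * β * γ) • triad a b c := by
  funext x y z
  simp only [triad_apply, Pi.smul_apply, smul_eq_mul]
  ring

/-- Two non-zero multiples of basis vectors coincide only on the same index with the same scalar.
[folklore] -/
private theorem single_smul_inj [DecidableEq ι] {i j : ι} {α α' : K} (hα : α ≠ 0)
    (h : α • (Pi.single i (1 : K)) = α' • Pi.single j 1) : i = j ∧ α = α' := by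
  have hi := congrFun h i
  simp only [Pi.smul_apply, Pi.single_eq_same, smul_eq_mul, mul_one] at hi
  by_cases hij : i = j
  · subst hij
    simp only [Pi.single_eq_same, mul_one] at hi
    exact ⟨rfl, hi⟩
  · rw [Pi.single_eq_of_ne hij, mul_zero] at hi
    exact absurd hi hα

end Rigidity

/-! ## §2 Irreducibility criterion over a field (line factors up to scalars) -/

section Irreducible

variable {K : Type*} [Field K] {ι κ μ σ : Type*} [Fintype σ]
variable {w : σ → ι → K} {u : σ → κ → K} {v : σ → μ → K}

/-- An injective family presents a multiset without repetitions. [folklore] -/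
private theorem nodup_fam_of_inj'
    (hnd : ∀ s s', s ≠ s' → triad (w s) (u s) (v s) ≠ triad (w s') (u s') (v s')) :
    (fam w u v).Nodup :=
  Multiset.Nodup.map (fun s s' h => by by_contra hne; exact hnd s s' hne h) Finset.univ.nodup

/-- **No reduction in the written case (Prop. 3) applies, over any field,** to an injectively
presented scheme in which for every member `t` some coordinate of `u_t` is non-zero while it
vanishes on every other member whose first factor is proportional to `w_t`: then `B^{(t)}` is not
a linear combination of those `B^{(i)}` (Def. 2 (2) fails).
[cite: KauersMoosbauer2022FlipGraphs, Prop. 3 and Def. 2] -/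
theorem not_redBase_fam_of_sep'
    (h0 : ∀ s, triad (w s) (u s) (v s) ≠ 0)
    (hnd : ∀ s s', s ≠ s' → triad (w s) (u s) (v s) ≠ triad (w s') (u s') (v s'))
    (hsep : ∀ t, ∃ x, u t x ≠ 0 ∧ ∀ i, i ≠ t → (∃ α : K, w t = α • w i) → u i x = 0)
    (S' : Multiset (ι → κ → μ → K)) : ¬ RedBase (fam w u v) S' := by
  rintro ⟨a₀, b₀, c₀, R, L, L₀, hS, hA, hB, -, -⟩
  have hT₀ : triad a₀ b₀ c₀ ∈ fam w u v := by rw [hS]; exact Multiset.mem_cons_self _ _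
  obtain ⟨t, ht⟩ := mem_fam.mp hT₀
  obtain ⟨α₀, β₀, γ₀, ha, hb, -, hαβγ⟩ := exists_smul_of_triad_eq ht (ht ▸ h0 t)
  have hα₀ : α₀ ≠ 0 := fun e => by rw [e, zero_mul, zero_mul] at hαβγ; exact zero_ne_one hαβγ
  have hβ₀ : β₀ ≠ 0 := fun e => by rw [e, mul_zero, zero_mul] at hαβγ; exact zero_ne_one hαβγ
  have hnd' := nodup_fam_of_inj' hnd
  rw [hS, Multiset.nodup_cons] at hnd'
  -- every modified element is a member `i ≠ t` with `w t ∝ w i` and `B`-factor a multiple of `u i`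
  have hmod : ∀ q ∈ L + L₀, ∃ i, i ≠ t ∧ (∃ α : K, w t = α • w i) ∧ ∃ β : K, q.1.2.1 = β • u i := by
    intro q hq
    have hmem : tr q.1 ∈ (L + L₀).map (fun q => tr q.1) + R :=
      Multiset.mem_add.mpr (Or.inl (Multiset.mem_map_of_mem _ hq))
    have hmem' : tr q.1 ∈ fam w u v := by rw [hS]; exact Multiset.mem_cons_of_mem hmem
    obtain ⟨i, hi⟩ := mem_fam.mp hmem'
    have hi' : triad q.1.1 q.1.2.1 q.1.2.2 = triad (w i) (u i) (v i) := hi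
    obtain ⟨α, β, γ, hqa, hqb, -, -⟩ := exists_smul_of_triad_eq hi' (hi' ▸ h0 i)
    have hit : i ≠ t := by
      rintro rfl
      exact hnd'.1 (by rw [ht, ← hi]; exact hmem)
    refine ⟨i, hit, ⟨α₀⁻¹ * (q.2.1 * α), ?_⟩, β, hqb⟩
    have e := hA q hq
    rw [hqa, ha, smul_smul] at e
    rw [mul_smul, ← e, smul_smul, inv_mul_cancel₀ hα₀, one_smul]
  -- evaluate `B^{(t)} = Σ β_q B^{(q)}` at the separating coordinate
  have hsum : ∀ (M : Multiset (κ → K)) (y : κ), M.sum y = (M.map fun f => f y).sum := by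
    intro M y
    induction M using Multiset.induction_on with
    | empty => simp
    | cons f M ih => simp [ih]
  obtain ⟨x, hx, hzero⟩ := hsep t
  apply mul_ne_zero hβ₀ hx
  have e : β₀ * u t x = b₀ x := by rw [hb, Pi.smul_apply, smul_eq_mul]
  rw [e, hB, hsum, Multiset.map_map]
  refine Multiset.sum_eq_zero fun y hy => ?_
  obtain ⟨q, hq, rfl⟩ := Multiset.mem_map.mp hy
  obtain ⟨i, hit, hwi, β, hqb⟩ := hmod q hq
  simp only [Function.comp_apply, Pi.smul_apply, smul_eq_mul, hqb, hzero i hit hwi, mul_zero]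

omit [Fintype σ] in
/-- `sw₁₂ (a⊗b⊗c) = b⊗a⊗c`. [folklore] -/
private theorem sw₁₂_triadF (a : ι → K) (b : κ → K) (c : μ → K) :
    sw₁₂ (triad a b c) = triad b a c := by
  funext x y z; simp only [sw₁₂, triad_apply]; ring

omit [Fintype σ] in
/-- `sw₂₃ (a⊗b⊗c) = a⊗c⊗b`. [folklore] -/
private theorem sw₂₃_triadF (a : ι → K) (b : κ → K) (c : μ → K) :
    sw₂₃ (triad a b c) = triad a c b := by
  funext x y z; simp only [sw₂₃, triad_apply]; ring

omit [Fintype σ] in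
/-- `sw₁₃ (a⊗b⊗c) = c⊗b⊗a`. [folklore] -/
private theorem sw₁₃_triadF (a : ι → K) (b : κ → K) (c : μ → K) :
    sw₁₃ (triad a b c) = triad c b a := by
  funext x y z; simp only [sw₁₃, triad_apply]; ring

omit [Fintype σ] in
/-- `cyc (a⊗b⊗c) = b⊗c⊗a`. [folklore] -/
private theorem cyc_triadF (a : ι → K) (b : κ → K) (c : μ → K) :
    cyc (triad a b c) = triad b c a := by
  funext x y z; simp only [cyc, triad_apply]; ring

omit [Fintype σ] in
/-- `cyc₂ (a⊗b⊗c) = c⊗a⊗b`. [folklore] -/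
private theorem cyc₂_triadF (a : ι → K) (b : κ → K) (c : μ → K) :
    cyc₂ (triad a b c) = triad c a b := by
  funext x y z; simp only [cyc₂, triad_apply]; ring

/-- The family with the slots `(1 2)` exchanged. [folklore] -/
private theorem fam_map_sw₁₂F (w : σ → ι → K) (u : σ → κ → K) (v : σ → μ → K) :
    (fam w u v).map sw₁₂ = fam u w v := by
  simp only [fam, Multiset.map_map, Function.comp_def, sw₁₂_triadF]

/-- The family with the slots `(2 3)` exchanged. [folklore] -/
private theorem fam_map_sw₂₃F (w : σ → ι → K) (u : σ → κ → K) (v : σ → μ → K) :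
    (fam w u v).map sw₂₃ = fam w v u := by
  simp only [fam, Multiset.map_map, Function.comp_def, sw₂₃_triadF]

/-- The family with the slots `(1 3)` exchanged. [folklore] -/
private theorem fam_map_sw₁₃F (w : σ → ι → K) (u : σ → κ → K) (v : σ → μ → K) :
    (fam w u v).map sw₁₃ = fam v u w := by
  simp only [fam, Multiset.map_map, Function.comp_def, sw₁₃_triadF]

/-- The family with the slots cyclically permuted. [folklore] -/
private theorem fam_map_cycF (w : σ → ι → K) (u : σ → κ → K) (v : σ → μ → K) :
    (fam w u v).map cyc = fam u v w := by
  simp only [fam, Multiset.map_map, Function.comp_def, cyc_triadF]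

/-- The family with the slots cyclically permuted the other way. [folklore] -/
private theorem fam_map_cyc₂F (w : σ → ι → K) (u : σ → κ → K) (v : σ → μ → K) :
    (fam w u v).map cyc₂ = fam v w u := by
  simp only [fam, Multiset.map_map, Function.comp_def, cyc₂_triadF]

end Irreducible

/-! ## §2b The flips of a family whose first factors are basis vectors (any field) -/

section GenericFlip

variable {K : Type*} [Field K] {σ X Y Z : Type*} [Fintype σ] [DecidableEq σ] [DecidableEq X]

/-- The index multiset split at two positions `p ≠ q` (bookkeeping for Def. 4: "`S` contains
`T₁, T₂` and the rest"). [cite: KauersMoosbauer2022FlipGraphs, Def. 4] -/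
theorem univ_val_eq_cons_cons {p q : σ} (hpq : p ≠ q) :
    (Finset.univ : Finset σ).val = p ::ₘ q ::ₘ ((Finset.univ.erase p).erase q).val := by
  have hq : q ∈ Finset.univ.erase p := Finset.mem_erase.2 ⟨hpq.symm, Finset.mem_univ q⟩
  have h1 : (Finset.univ : Finset σ) = insert p (Finset.univ.erase p) :=
    (Finset.insert_erase (Finset.mem_univ p)).symm
  have h2 : (Finset.univ : Finset σ).erase p = insert q ((Finset.univ.erase p).erase q) :=
    (Finset.insert_erase hq).symm
  have hp' : p ∉ insert q ((Finset.univ.erase p).erase q) := by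
    rw [← h2]; exact Finset.notMem_erase p _
  have hq' : q ∉ (Finset.univ.erase p).erase q := Finset.notMem_erase q _
  conv_lhs => rw [h1, h2]
  rw [Finset.insert_val_of_notMem hp', Finset.insert_val_of_notMem hq']

variable {w : σ → X → K} {u : σ → Y → K} {v : σ → Z → K}

/-- **The flips (written case of Def. 4) of an injectively presented family whose first factors
are basis vectors `w_s = e_{g(s)}`, over any field:** two members `p ≠ q` with `w_p = w_q` are
replaced by `w_p⊗u_p⊗v_p + c·w_p⊗u_p⊗v_q` and `w_q⊗u_q⊗v_q − c·w_p⊗u_p⊗v_q`, `c ≠ 0` — both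
choices of `T` and all presentations of the two elements (which over a general field carry free
scalars, `exists_smul_of_triad_eq`) land in this one-parameter family.
[cite: KauersMoosbauer2022FlipGraphs, Def. 4 with Def. 1] -/
theorem exists_nf_of_flipBase_fam (w : σ → X → K) (u : σ → Y → K) (v : σ → Z → K) (g : σ → X)
    (hw : ∀ s, w s = Pi.single (g s) 1) (h0 : ∀ s, triad (w s) (u s) (v s) ≠ 0)
    (hinj : ∀ s s', triad (w s) (u s) (v s) = triad (w s') (u s') (v s') → s = s')
    {S' : Multiset (X → Y → Z → K)} (h : FlipBase (fam w u v) S') :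
    ∃ (p q : σ) (c : K), p ≠ q ∧ w p = w q ∧ c ≠ 0 ∧
      S' = (triad (w p) (u p) (v p) + c • triad (w p) (u p) (v q)) ::ₘ
        (triad (w q) (u q) (v q) - c • triad (w p) (u p) (v q)) ::ₘ
        ((Finset.univ.erase p).erase q).val.map (fun s => triad (w s) (u s) (v s)) := by
  obtain ⟨a, b, b', c, c', R, hS, hS'⟩ := h
  have h₁ : triad a b c ∈ fam w u v := by rw [hS]; exact Multiset.mem_cons_self _ _
  have h₂ : triad a b' c' ∈ fam w u v := by
    rw [hS]; exact Multiset.mem_cons_of_mem (Multiset.mem_cons_self _ _)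
  obtain ⟨p, hp⟩ := mem_fam.mp h₁
  obtain ⟨q, hq⟩ := mem_fam.mp h₂
  have hp0 : triad a b c ≠ 0 := by rw [hp]; exact h0 p
  have hq0 : triad a b' c' ≠ 0 := by rw [hq]; exact h0 q
  obtain ⟨α, β, γ, ha, hb, hc, hαβγ⟩ := exists_smul_of_triad_eq hp hp0
  obtain ⟨α', β', γ', ha', hb', hc', hαβγ'⟩ := exists_smul_of_triad_eq hq hq0
  have hα : α ≠ 0 := fun e => by rw [e, zero_mul, zero_mul] at hαβγ; exact zero_ne_one hαβγ
  have hβ : β ≠ 0 := fun e => by rw [e, mul_zero, zero_mul] at hαβγ; exact zero_ne_one hαβγ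
  have hγ : γ ≠ 0 := fun e => by rw [e, mul_zero] at hαβγ; exact zero_ne_one hαβγ
  have hβ' : β' ≠ 0 := fun e => by rw [e, mul_zero, zero_mul] at hαβγ'; exact zero_ne_one hαβγ'
  have hγ' : γ' ≠ 0 := fun e => by rw [e, mul_zero] at hαβγ'; exact zero_ne_one hαβγ'
  -- the shared first factor forces the same basis vector and the same scalar
  have eW : α • Pi.single (g p) (1 : K) = α' • Pi.single (g q) 1 := by rw [← hw, ← hw, ← ha, ← ha']
  obtain ⟨hg, -⟩ := single_smul_inj hα eW
  have hwpq : w p = w q := by rw [hw, hw, hg]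
  -- the two flipped elements are different members
  have hpq : p ≠ q := by
    rintro rfl
    have hnd' := nodup_fam_of_inj' (w := w) (u := u) (v := v)
      (fun s s' hss' e => hss' (hinj s s' e))
    rw [hS, Multiset.nodup_cons] at hnd'
    exact hnd'.1 (by rw [hp, ← hq]; exact Multiset.mem_cons_self _ _)
  -- the rest `R` is the family off `p, q`
  have hR : R = ((Finset.univ.erase p).erase q).val.map (fun s => triad (w s) (u s) (v s)) := by
    have e := hS
    rw [fam, univ_val_eq_cons_cons hpq, Multiset.map_cons, Multiset.map_cons, ← hp, ← hq] at e
    exact ((Multiset.cons_inj_right _).1 ((Multiset.cons_inj_right _).1 e)).symm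
  rcases hS' with hS' | hS'
  · -- `T = A ⊗ B ⊗ Γ'`
    refine ⟨p, q, α * β * γ', hpq, hwpq, mul_ne_zero (mul_ne_zero hα hβ) hγ', ?_⟩
    have hT : triad a b c' = (α * β * γ') • triad (w p) (u p) (v q) := by
      rw [ha, hb, hc', triad_smul₃]
    rw [hS', hR, hT, hp, hq]
  · -- `T = A ⊗ B' ⊗ Γ`: the pair in the other order, with the opposite scalar
    refine ⟨q, p, -(α * β' * γ), hpq.symm, hwpq.symm,
      neg_ne_zero.2 (mul_ne_zero (mul_ne_zero hα hβ') hγ), ?_⟩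
    have hT : triad a b' c = (α * β' * γ) • triad (w q) (u q) (v p) := by
      rw [ha, hb', hc, triad_smul₃, hwpq]
    rw [hS', hR, hT, hp, hq, neg_smul, ← sub_eq_add_neg, sub_neg_eq_add, Multiset.cons_swap,
      Finset.erase_right_comm]

end GenericFlip

end FlipGraph

/-! ## §3 The standard algorithm of `⟨n,n,n⟩` over a field: its elements, its flips, its irreducibility -/

namespace StdFlips

open FlipGraph

variable (K : Type*) [Field K] (n : ℕ)

/-- The index set `(κ, μ, ν)` of the products of the standard algorithm.
[cite: KauersMoosbauer2022FlipGraphs, §2 (the standard algorithm)] -/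
abbrev Idx (n : ℕ) : Type := Fin n × Fin n × Fin n

/-- The `Z`-factor `e_{κν}` of product `(κ,μ,ν)`. [cite: KauersMoosbauer2022FlipGraphs, §2] -/
def W (p : Idx n) : Fin n × Fin n → K := Pi.single (p.1, p.2.2) 1
/-- The `X`-factor `e_{κμ}` of product `(κ,μ,ν)`. [cite: KauersMoosbauer2022FlipGraphs, §2] -/
def U (p : Idx n) : Fin n × Fin n → K := Pi.single (p.1, p.2.1) 1
/-- The `Y`-factor `e_{μν}` of product `(κ,μ,ν)`. [cite: KauersMoosbauer2022FlipGraphs, §2] -/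
def V (p : Idx n) : Fin n × Fin n → K := Pi.single (p.2.1, p.2.2) 1

/-- The product `E_p = e_{κν} ⊗ e_{κμ} ⊗ e_{μν}` of the standard algorithm.
[cite: KauersMoosbauer2022FlipGraphs, §2 (the standard algorithm)] -/
def E (p : Idx n) : (Fin n × Fin n) → (Fin n × Fin n) → (Fin n × Fin n) → K :=
  triad (W K n p) (U K n p) (V K n p)

/-- The standard algorithm's elements are the family `(W, U, V)`.
[cite: KauersMoosbauer2022FlipGraphs, §2 (the standard algorithm)] -/
theorem stdScheme_elts :
    (stdScheme (matMulTensor K n n n)).elts = fam (W K n) (U K n) (V K n) := by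
  show stdElts _ = _
  rw [stdElts_matMulTensor]
  rfl

variable {K n}

/-- The value of `E_p` at its own position is `1`. [cite: KauersMoosbauer2022FlipGraphs, §2] -/
theorem E_apply_self (p : Idx n) : E K n p (p.1, p.2.2) (p.1, p.2.1) (p.2.1, p.2.2) = 1 := by
  simp [E, W, U, V, triad_apply]

/-- The value of `E_q` at the position of `E_p` vanishes for `q ≠ p`.
[cite: KauersMoosbauer2022FlipGraphs, §2] -/
theorem E_apply_of_ne {p q : Idx n} (h : q ≠ p) :
    E K n q (p.1, p.2.2) (p.1, p.2.1) (p.2.1, p.2.2) = 0 := by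
  obtain ⟨κ, μ, ν⟩ := p
  obtain ⟨κ', μ', ν'⟩ := q
  simp only [E, W, U, V, triad_apply]
  by_cases h1 : (κ, ν) = (κ', ν')
  · by_cases h2 : (κ, μ) = (κ', μ')
    · exfalso
      obtain ⟨rfl, rfl⟩ := Prod.mk.inj h1
      obtain ⟨-, rfl⟩ := Prod.mk.inj h2
      exact h rfl
    · rw [Pi.single_eq_of_ne h2, mul_zero, zero_mul]
  · rw [Pi.single_eq_of_ne h1, zero_mul, zero_mul]

/-- The products of the standard algorithm are non-zero. [cite: KauersMoosbauer2022FlipGraphs, Def. 1] -/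
theorem E_ne_zero (p : Idx n) : E K n p ≠ 0 := fun h => by
  have e := congrFun (congrFun (congrFun h (p.1, p.2.2)) (p.1, p.2.1)) (p.2.1, p.2.2)
  rw [E_apply_self] at e
  exact one_ne_zero e

/-- … and pairwise distinct. [cite: KauersMoosbauer2022FlipGraphs, Def. 1] -/
theorem E_injective : Function.Injective (E K n) := fun p q h => by
  by_contra hne
  have e := congrFun (congrFun (congrFun h (p.1, p.2.2)) (p.1, p.2.1)) (p.2.1, p.2.2)
  rw [E_apply_self, E_apply_of_ne (Ne.symm hne)] at e
  exact one_ne_zero e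

/-- The standard algorithm split at two products `p ≠ q`. [cite: KauersMoosbauer2022FlipGraphs, §2] -/
theorem fam_std_eq_cons_cons {p q : Idx n} (hpq : p ≠ q) :
    fam (W K n) (U K n) (V K n) =
      E K n p ::ₘ E K n q ::ₘ ((Finset.univ.erase p).erase q).val.map (E K n) := by
  rw [fam, univ_val_eq_cons_cons hpq, Multiset.map_cons, Multiset.map_cons]
  rfl

/-- The "wrong-index" rank-one tensor `D(p,q) = e_{κν} ⊗ e_{κμ} ⊗ e_{μ'ν}` of two products
`p = (κ,μ,ν)`, `q = (κ,μ',ν)` with the same `Z`-factor (the tensor `T = A⊗B⊗Γ'` of Def. 4 for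
the pair `E_p, E_q`). [cite: KauersMoosbauer2022FlipGraphs, Def. 4] -/
def D (K : Type*) [Field K] (n : ℕ) (p q : Idx n) :
    (Fin n × Fin n) → (Fin n × Fin n) → (Fin n × Fin n) → K :=
  triad (W K n p) (U K n p) (V K n q)

/-- **The normal form `N(p, q, c)` of a flip of the standard algorithm:** `E_p, E_q` replaced by
`E_p + c·D(p,q)` and `E_q − c·D(p,q)`. [cite: KauersMoosbauer2022FlipGraphs, Def. 4 with §4] -/
def normalForm (K : Type*) [Field K] (n : ℕ) (p q : Idx n) (c : K) :
    Multiset ((Fin n × Fin n) → (Fin n × Fin n) → (Fin n × Fin n) → K) :=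
  (E K n p + c • D K n p q) ::ₘ (E K n q - c • D K n p q) ::ₘ
    ((Finset.univ.erase p).erase q).val.map (E K n)

/-- **Every flip of the standard algorithm in the written case of Def. 4 (shared `Z`-factor), over
any field, is a normal form `N(p, q, c)`** with `p ≠ q`, `W p = W q` (the two products share their
`Z`-factor) and `c ≠ 0` — whatever presentations `A⊗B⊗Γ`, `A⊗B'⊗Γ'` of the two elements and
whichever of the two tensors `T` are used. [cite: KauersMoosbauer2022FlipGraphs, Def. 4 with §4
("any two schemes obtained by a flip from the standard algorithm")] -/
theorem exists_normalForm_of_flipBase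
    {S' : Multiset ((Fin n × Fin n) → (Fin n × Fin n) → (Fin n × Fin n) → K)}
    (h : FlipBase (fam (W K n) (U K n) (V K n)) S') :
    ∃ (p q : Idx n) (c : K), p ≠ q ∧ W K n p = W K n q ∧ c ≠ 0 ∧ S' = normalForm K n p q c :=
  exists_nf_of_flipBase_fam (W K n) (U K n) (V K n) (fun s => (s.1, s.2.2)) (fun _ => rfl)
    E_ne_zero (fun _ _ e => E_injective e) h

/-- **Conversely every normal form is a flip of the standard algorithm** (Def. 4 with
`A⊗B⊗Γ = (c·e_{κν}) ⊗ e_{κμ} ⊗ (c⁻¹·e_{μν})`-free presentation: `T = E_p`'s `A, B` and `c·` the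
`Γ` of `E_q`). [cite: KauersMoosbauer2022FlipGraphs, Def. 4] -/
theorem flipBase_normalForm {p q : Idx n} (hpq : p ≠ q) (hW : W K n p = W K n q) {c : K}
    (hc : c ≠ 0) : FlipBase (fam (W K n) (U K n) (V K n)) (normalForm K n p q c) := by
  -- present `E_q = W p ⊗ (c⁻¹ • U q) ⊗ (c • V q)` so that `A⊗B⊗Γ' = c • D(p,q)`
  have h2 : triad (W K n p) (c⁻¹ • U K n q) (c • V K n q) = E K n q := by
    rw [hW, show triad (W K n q) (c⁻¹ • U K n q) (c • V K n q) =
      triad ((1 : K) • W K n q) (c⁻¹ • U K n q) (c • V K n q) by rw [one_smul], triad_smul₃,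
      one_mul, inv_mul_cancel₀ hc, one_smul]
    rfl
  have h3 : triad (W K n p) (U K n p) (c • V K n q) = c • D K n p q := by
    rw [show triad (W K n p) (U K n p) (c • V K n q) =
      triad ((1 : K) • W K n p) ((1 : K) • U K n p) (c • V K n q) by rw [one_smul, one_smul],
      triad_smul₃, one_mul, one_mul]
    rfl
  refine ⟨W K n p, U K n p, c⁻¹ • U K n q, V K n p, c • V K n q,
    ((Finset.univ.erase p).erase q).val.map (E K n), ?_, Or.inl ?_⟩
  · rw [fam_std_eq_cons_cons hpq, h2]
    rfl
  · rw [h3, h2]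
    rfl

/-! ### Irreducibility of the standard algorithm over any field -/

/-- `W t ∝ W i` forces the same `Z`-index. [cite: KauersMoosbauer2022FlipGraphs, §2] -/
private theorem zIdx_eq_of_prop {t i : Idx n} (h : ∃ α : K, W K n t = α • W K n i) :
    (t.1, t.2.2) = (i.1, i.2.2) := by
  obtain ⟨α, hα⟩ := h
  have e := congrFun hα (t.1, t.2.2)
  simp only [W, Pi.single_eq_same, Pi.smul_apply, smul_eq_mul] at e
  by_contra hne
  rw [Pi.single_eq_of_ne hne, mul_zero] at e
  exact one_ne_zero e

/-- `U t ∝ U i` forces the same `X`-index. [cite: KauersMoosbauer2022FlipGraphs, §2] -/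
private theorem xIdx_eq_of_prop {t i : Idx n} (h : ∃ α : K, U K n t = α • U K n i) :
    (t.1, t.2.1) = (i.1, i.2.1) := by
  obtain ⟨α, hα⟩ := h
  have e := congrFun hα (t.1, t.2.1)
  simp only [U, Pi.single_eq_same, Pi.smul_apply, smul_eq_mul] at e
  by_contra hne
  rw [Pi.single_eq_of_ne hne, mul_zero] at e
  exact one_ne_zero e

/-- `V t ∝ V i` forces the same `Y`-index. [cite: KauersMoosbauer2022FlipGraphs, §2] -/
private theorem yIdx_eq_of_prop {t i : Idx n} (h : ∃ α : K, V K n t = α • V K n i) :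
    (t.2.1, t.2.2) = (i.2.1, i.2.2) := by
  obtain ⟨α, hα⟩ := h
  have e := congrFun hα (t.2.1, t.2.2)
  simp only [V, Pi.single_eq_same, Pi.smul_apply, smul_eq_mul] at e
  by_contra hne
  rw [Pi.single_eq_of_ne hne, mul_zero] at e
  exact one_ne_zero e

/-- Non-vanishing of the six slot-permuted presentations. [folklore] -/
private theorem triad_ne_zero₃ {a : Fin n × Fin n → K} {b : Fin n × Fin n → K}
    {c : Fin n × Fin n → K} (ha : a ≠ 0) (hb : b ≠ 0) (hc : c ≠ 0) : triad a b c ≠ 0 := by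
  obtain ⟨x, hx⟩ := Function.ne_iff.mp ha
  obtain ⟨y, hy⟩ := Function.ne_iff.mp hb
  obtain ⟨z, hz⟩ := Function.ne_iff.mp hc
  intro h
  have h' := congrFun (congrFun (congrFun h x) y) z
  simp only [triad_apply, Pi.zero_apply] at h'
  exact mul_ne_zero (mul_ne_zero hx hy) hz h'

/-- The factors of the standard algorithm are non-zero. [cite: KauersMoosbauer2022FlipGraphs, Def. 1] -/
theorem WUV_ne_zero (s : Idx n) : W K n s ≠ 0 ∧ U K n s ≠ 0 ∧ V K n s ≠ 0 := by
  refine ⟨fun h => ?_, fun h => ?_, fun h => ?_⟩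
  · have e := congrFun h (s.1, s.2.2); simp [W] at e
  · have e := congrFun h (s.1, s.2.1); simp [U] at e
  · have e := congrFun h (s.2.1, s.2.2); simp [V] at e

/-- A product of the standard algorithm is determined by its `Z`- and `X`-factors.
[cite: KauersMoosbauer2022FlipGraphs, §2 (the standard algorithm)] -/
theorem idx_eq_of_factors_eq {s s' : Idx n} (h1 : W K n s = W K n s') (h2 : U K n s = U K n s') :
    s = s' := by
  have e1 := zIdx_eq_of_prop (K := K) (t := s) (i := s') ⟨1, by rw [one_smul, h1]⟩
  have e2 := xIdx_eq_of_prop (K := K) (t := s) (i := s') ⟨1, by rw [one_smul, h2]⟩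
  obtain ⟨hκ, hν⟩ := Prod.mk.inj e1
  obtain ⟨-, hμ⟩ := Prod.mk.inj e2
  exact Prod.ext hκ (Prod.ext hμ hν)

/-- Injectivity of any slot-permuted presentation of the standard algorithm (from rigidity and
`idx_eq_of_factors_eq`). [folklore] -/
private theorem inj_perm {a b c : Idx n → Fin n × Fin n → K}
    (h0 : ∀ s, triad (a s) (b s) (c s) ≠ 0)
    (hidx : ∀ s s', (∃ α : K, a s = α • a s') → (∃ β : K, b s = β • b s') →
      (∃ γ : K, c s = γ • c s') → s = s') :
    ∀ s s', s ≠ s' → triad (a s) (b s) (c s) ≠ triad (a s') (b s') (c s') := by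
  intro s s' hss' e
  obtain ⟨α, β, γ, h1, h2, h3, -⟩ := exists_smul_of_triad_eq e (h0 s)
  exact hss' (hidx s s' ⟨α, h1⟩ ⟨β, h2⟩ ⟨γ, h3⟩)

/-- **KM §4 "None of them is reducible", for the standard algorithm itself, over every field:**
no reduction (any of the six cases of Def. 2 / Prop. 3) applies to the standard algorithm of
`⟨n,n,n⟩`. [cite: KauersMoosbauer2022FlipGraphs, §4 ("None of them is reducible"), Def. 2, Prop. 3] -/
theorem not_reduces_std (S' : Multiset ((Fin n × Fin n) → (Fin n × Fin n) → (Fin n × Fin n) → K)) :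
    ¬ Reduces (stdScheme (matMulTensor K n n n)).elts S' := by
  rw [stdScheme_elts]
  have hne := WUV_ne_zero (K := K) (n := n)
  -- index consequences of proportional factors
  have zI := fun t i (h : ∃ α : K, W K n t = α • W K n i) => zIdx_eq_of_prop h
  have xI := fun t i (h : ∃ α : K, U K n t = α • U K n i) => xIdx_eq_of_prop h
  have yI := fun t i (h : ∃ α : K, V K n t = α • V K n i) => yIdx_eq_of_prop h
  have hidx : ∀ s s' : Idx n, (s.1, s.2.2) = (s'.1, s'.2.2) → (s.1, s.2.1) = (s'.1, s'.2.1) → s = s' :=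
    fun s s' e1 e2 => by
      obtain ⟨hκ, hν⟩ := Prod.mk.inj e1
      obtain ⟨-, hμ⟩ := Prod.mk.inj e2
      exact Prod.ext hκ (Prod.ext hμ hν)
  have hidx' : ∀ s s' : Idx n, (s.1, s.2.2) = (s'.1, s'.2.2) → (s.2.1, s.2.2) = (s'.2.1, s'.2.2) →
      s = s' := fun s s' e1 e3 => by
    obtain ⟨hκ, hν⟩ := Prod.mk.inj e1
    obtain ⟨hμ, -⟩ := Prod.mk.inj e3
    exact Prod.ext hκ (Prod.ext hμ hν)
  have hidx'' : ∀ s s' : Idx n, (s.1, s.2.1) = (s'.1, s'.2.1) → (s.2.1, s.2.2) = (s'.2.1, s'.2.2) →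
      s = s' := fun s s' e2 e3 => by
    obtain ⟨hκ, hμ⟩ := Prod.mk.inj e2
    obtain ⟨-, hν⟩ := Prod.mk.inj e3
    exact Prod.ext hκ (Prod.ext hμ hν)
  -- single-vector evaluations
  have sng : ∀ (i j : Fin n × Fin n), (Pi.single i (1 : K) : Fin n × Fin n → K) j = if j = i then 1 else 0 :=
    fun i j => by rw [Pi.single_apply]
  rintro (h | h | h | h | h | h)
  · -- `A = Z` line, `B = X` dependent
    refine not_redBase_fam_of_sep' (fun s => triad_ne_zero₃ (hne s).1 (hne s).2.1 (hne s).2.2)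
      (inj_perm (fun s => triad_ne_zero₃ (hne s).1 (hne s).2.1 (hne s).2.2)
        fun s s' h1 h2 _ => hidx s s' (zI s s' h1) (xI s s' h2)) (fun t => ?_) S' h
    refine ⟨(t.1, t.2.1), by simp [U], fun i hit hw => ?_⟩
    have e := zI t i hw
    rw [U, sng, if_neg]
    intro e2
    exact hit (hidx i t e.symm e2.symm)
  · rw [fam_map_sw₂₃F] at h
    refine not_redBase_fam_of_sep' (fun s => triad_ne_zero₃ (hne s).1 (hne s).2.2 (hne s).2.1)
      (inj_perm (fun s => triad_ne_zero₃ (hne s).1 (hne s).2.2 (hne s).2.1)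
        fun s s' h1 h3 _ => hidx' s s' (zI s s' h1) (yI s s' h3)) (fun t => ?_) _ h
    refine ⟨(t.2.1, t.2.2), by simp [V], fun i hit hw => ?_⟩
    have e := zI t i hw
    rw [V, sng, if_neg]
    intro e3
    exact hit (hidx' i t e.symm e3.symm)
  · rw [fam_map_sw₁₂F] at h
    refine not_redBase_fam_of_sep' (fun s => triad_ne_zero₃ (hne s).2.1 (hne s).1 (hne s).2.2)
      (inj_perm (fun s => triad_ne_zero₃ (hne s).2.1 (hne s).1 (hne s).2.2)
        fun s s' h2 h1 _ => hidx s s' (zI s s' h1) (xI s s' h2)) (fun t => ?_) _ h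
    refine ⟨(t.1, t.2.2), by simp [W], fun i hit hu => ?_⟩
    have e := xI t i hu
    rw [W, sng, if_neg]
    intro e1
    exact hit (hidx i t e1.symm e.symm)
  · rw [fam_map_cycF] at h
    refine not_redBase_fam_of_sep' (fun s => triad_ne_zero₃ (hne s).2.1 (hne s).2.2 (hne s).1)
      (inj_perm (fun s => triad_ne_zero₃ (hne s).2.1 (hne s).2.2 (hne s).1)
        fun s s' h2 h3 _ => hidx'' s s' (xI s s' h2) (yI s s' h3)) (fun t => ?_) _ h
    refine ⟨(t.2.1, t.2.2), by simp [V], fun i hit hu => ?_⟩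
    have e := xI t i hu
    rw [V, sng, if_neg]
    intro e3
    exact hit (hidx'' i t e.symm e3.symm)
  · rw [fam_map_cyc₂F] at h
    refine not_redBase_fam_of_sep' (fun s => triad_ne_zero₃ (hne s).2.2 (hne s).1 (hne s).2.1)
      (inj_perm (fun s => triad_ne_zero₃ (hne s).2.2 (hne s).1 (hne s).2.1)
        fun s s' h3 h1 _ => hidx' s s' (zI s s' h1) (yI s s' h3)) (fun t => ?_) _ h
    refine ⟨(t.1, t.2.2), by simp [W], fun i hit hv => ?_⟩
    have e := yI t i hv
    rw [W, sng, if_neg]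
    intro e1
    exact hit (hidx' i t e1.symm e.symm)
  · rw [fam_map_sw₁₃F] at h
    refine not_redBase_fam_of_sep' (fun s => triad_ne_zero₃ (hne s).2.2 (hne s).2.1 (hne s).1)
      (inj_perm (fun s => triad_ne_zero₃ (hne s).2.2 (hne s).2.1 (hne s).1)
        fun s s' h3 h2 _ => hidx'' s s' (xI s s' h2) (yI s s' h3)) (fun t => ?_) _ h
    refine ⟨(t.1, t.2.1), by simp [U], fun i hit hv => ?_⟩
    have e := yI t i hv
    rw [U, sng, if_neg]
    intro e2
    exact hit (hidx'' i t e2.symm e.symm)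

/-- **Hence every neighbour of the standard algorithm is a flip of it** (Def. 8: `E₁ ∪ E₂`; no
`E₂` edge leaves the standard algorithm), over every field. [cite: KauersMoosbauer2022FlipGraphs, §4, Def. 8] -/
theorem flips_of_adj_std {y : Scheme (matMulTensor K n n n)}
    (h : Adj (stdScheme (matMulTensor K n n n)) y) :
    Flips (stdScheme (matMulTensor K n n n)).elts y.elts :=
  h.resolve_right (not_reduces_std y.elts)

end StdFlips

/-! ## §4 All flips of the standard algorithm are `G`-equivalent (any field, any `n`)

KM §4: "any two schemes obtained by a flip from the standard algorithm are equivalent" — here for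
`⟨n,n,n⟩` over an arbitrary field and every `n`, by explicit group elements: a diagonal sandwich
rescales the flip parameter `c` to `1`, a permutation sandwich moves the pair of flipped products
to any other admissible pair, and the cyclic shift carries the flips with shared `Z`-factor to
those with shared `Y`- and `X`-factor. -/

namespace StdFlips

open FlipGraph
open scoped Kronecker Matrix

variable {K : Type*} [Field K] {n : ℕ}

/-! ### The flips in the other two slots -/

/-- The "wrong-index" tensor of a flip with shared `Y`-factor: `e_{κ'ν} ⊗ e_{κμ} ⊗ e_{μν}` for
`P = (κ,μ,ν)`, `Q = (κ',μ,ν)`. [cite: KauersMoosbauer2022FlipGraphs, Def. 4] -/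
def D₃ (K : Type*) [Field K] (n : ℕ) (P Q : Idx n) :
    (Fin n × Fin n) → (Fin n × Fin n) → (Fin n × Fin n) → K :=
  triad (W K n Q) (U K n P) (V K n P)

/-- The normal form of a flip of the standard algorithm with shared `Y`-factor.
[cite: KauersMoosbauer2022FlipGraphs, Def. 4 with §4] -/
def normalForm₃ (K : Type*) [Field K] (n : ℕ) (P Q : Idx n) (c : K) :
    Multiset ((Fin n × Fin n) → (Fin n × Fin n) → (Fin n × Fin n) → K) :=
  (E K n P + c • D₃ K n P Q) ::ₘ (E K n Q - c • D₃ K n P Q) ::ₘ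
    ((Finset.univ.erase P).erase Q).val.map (E K n)

omit [Field K] in
/-- `sw₁₂` twice is the identity on multisets. [folklore] -/
private theorem map_sw₁₂_sw₁₂
    (M : Multiset ((Fin n × Fin n) → (Fin n × Fin n) → (Fin n × Fin n) → K)) :
    (M.map sw₁₂).map sw₁₂ = M := by
  rw [Multiset.map_map]; exact Multiset.map_id' M

omit [Field K] in
/-- `sw₁₃` twice is the identity on multisets. [folklore] -/
private theorem map_sw₁₃_sw₁₃
    (M : Multiset ((Fin n × Fin n) → (Fin n × Fin n) → (Fin n × Fin n) → K)) :
    (M.map sw₁₃).map sw₁₃ = M := by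
  rw [Multiset.map_map]; exact Multiset.map_id' M

/-- `sw₁₂` is additive. [folklore] -/
private theorem sw₁₂_add' (A B : (Fin n × Fin n) → (Fin n × Fin n) → (Fin n × Fin n) → K) :
    sw₁₂ (A + B) = sw₁₂ A + sw₁₂ B := rfl

/-- `sw₁₂` respects differences. [folklore] -/
private theorem sw₁₂_sub' (A B : (Fin n × Fin n) → (Fin n × Fin n) → (Fin n × Fin n) → K) :
    sw₁₂ (A - B) = sw₁₂ A - sw₁₂ B := rfl

/-- `sw₁₂` is homogeneous. [folklore] -/
private theorem sw₁₂_smul' (c : K) (A : (Fin n × Fin n) → (Fin n × Fin n) → (Fin n × Fin n) → K) :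
    sw₁₂ (c • A) = c • sw₁₂ A := rfl

/-- `sw₁₃` is additive. [folklore] -/
private theorem sw₁₃_add' (A B : (Fin n × Fin n) → (Fin n × Fin n) → (Fin n × Fin n) → K) :
    sw₁₃ (A + B) = sw₁₃ A + sw₁₃ B := rfl

/-- `sw₁₃` respects differences. [folklore] -/
private theorem sw₁₃_sub' (A B : (Fin n × Fin n) → (Fin n × Fin n) → (Fin n × Fin n) → K) :
    sw₁₃ (A - B) = sw₁₃ A - sw₁₃ B := rfl

/-- `sw₁₃` is homogeneous. [folklore] -/
private theorem sw₁₃_smul' (c : K) (A : (Fin n × Fin n) → (Fin n × Fin n) → (Fin n × Fin n) → K) :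
    sw₁₃ (c • A) = c • sw₁₃ A := rfl

/-- **The flips of the standard algorithm with shared `X`-factor** (Def. 4 "analogously", slot
`(1 2)`) are the normal forms `N(p, q, c)` with `U p = U q`. [cite: KauersMoosbauer2022FlipGraphs, Def. 4 with §4] -/
theorem exists_normalForm_of_flipBase_sw₁₂
    {S' : Multiset ((Fin n × Fin n) → (Fin n × Fin n) → (Fin n × Fin n) → K)}
    (h : FlipBase ((fam (W K n) (U K n) (V K n)).map sw₁₂) (S'.map sw₁₂)) :
    ∃ (p q : Idx n) (c : K), p ≠ q ∧ U K n p = U K n q ∧ c ≠ 0 ∧ S' = normalForm K n p q c := by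
  rw [fam_map_sw₁₂F] at h
  have hne := WUV_ne_zero (K := K) (n := n)
  obtain ⟨p, q, c, hpq, hU, hc, hS'⟩ := exists_nf_of_flipBase_fam (U K n) (W K n) (V K n)
    (fun s => (s.1, s.2.1)) (fun _ => rfl)
    (fun s => triad_ne_zero₃ (hne s).2.1 (hne s).1 (hne s).2.2)
    (fun s s' e => E_injective (by
      have e' := congrArg sw₁₂ e
      rwa [sw₁₂_triadF, sw₁₂_triadF] at e')) h
  refine ⟨p, q, c, hpq, hU, hc, ?_⟩
  rw [← map_sw₁₂_sw₁₂ S', hS']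
  simp only [Multiset.map_cons, Multiset.map_map, Function.comp_def, sw₁₂_add', sw₁₂_sub',
    sw₁₂_smul', sw₁₂_triadF]
  rfl

/-- **The flips of the standard algorithm with shared `Y`-factor** (Def. 4 "analogously", slot
`(1 3)`) are the normal forms `N₃(P, Q, c)` with `V P = V Q`. [cite: KauersMoosbauer2022FlipGraphs, Def. 4 with §4] -/
theorem exists_normalForm₃_of_flipBase_sw₁₃
    {S' : Multiset ((Fin n × Fin n) → (Fin n × Fin n) → (Fin n × Fin n) → K)}
    (h : FlipBase ((fam (W K n) (U K n) (V K n)).map sw₁₃) (S'.map sw₁₃)) :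
    ∃ (P Q : Idx n) (c : K), P ≠ Q ∧ V K n P = V K n Q ∧ c ≠ 0 ∧ S' = normalForm₃ K n P Q c := by
  rw [fam_map_sw₁₃F] at h
  have hne := WUV_ne_zero (K := K) (n := n)
  obtain ⟨p, q, c, hpq, hV, hc, hS'⟩ := exists_nf_of_flipBase_fam (V K n) (U K n) (W K n)
    (fun s => (s.2.1, s.2.2)) (fun _ => rfl)
    (fun s => triad_ne_zero₃ (hne s).2.2 (hne s).2.1 (hne s).1)
    (fun s s' e => E_injective (by
      have e' := congrArg sw₁₃ e
      rwa [sw₁₃_triadF, sw₁₃_triadF] at e')) h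
  refine ⟨p, q, c, hpq, hV, hc, ?_⟩
  rw [← map_sw₁₃_sw₁₃ S', hS']
  simp only [Multiset.map_cons, Multiset.map_map, Function.comp_def, sw₁₃_add', sw₁₃_sub',
    sw₁₃_smul', sw₁₃_triadF]
  rfl

/-- **All flips of the standard algorithm, over any field:** shared `Z`-, `X`- or `Y`-factor, each
a normal form. [cite: KauersMoosbauer2022FlipGraphs, Def. 4 with §4] -/
theorem flips_std_cases {S' : Multiset ((Fin n × Fin n) → (Fin n × Fin n) → (Fin n × Fin n) → K)}
    (h : Flips (fam (W K n) (U K n) (V K n)) S') :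
    (∃ (p q : Idx n) (c : K), p ≠ q ∧ W K n p = W K n q ∧ c ≠ 0 ∧ S' = normalForm K n p q c) ∨
    (∃ (p q : Idx n) (c : K), p ≠ q ∧ U K n p = U K n q ∧ c ≠ 0 ∧ S' = normalForm K n p q c) ∨
    (∃ (P Q : Idx n) (c : K), P ≠ Q ∧ V K n P = V K n Q ∧ c ≠ 0 ∧ S' = normalForm₃ K n P Q c) := by
  rcases h with h | h | h
  · exact Or.inl (exists_normalForm_of_flipBase h)
  · exact Or.inr (Or.inl (exists_normalForm_of_flipBase_sw₁₂ h))
  · exact Or.inr (Or.inr (exists_normalForm₃_of_flipBase_sw₁₃ h))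

/-! ### Transport of normal forms along a linear map permuting the standard products -/

/-- The index multiset is invariant under a permutation of the indices. [folklore] -/
private theorem univ_val_map_equiv (f : Idx n ≃ Idx n) :
    (Finset.univ : Finset (Idx n)).val.map f = Finset.univ.val := by
  rw [← Equiv.coe_toEmbedding, ← Finset.map_val, Finset.map_univ_equiv]

/-- A linear map permuting the standard products maps the standard algorithm off `p, q` to the
standard algorithm off `f p, f q`. [cite: KauersMoosbauer2022FlipGraphs, §2 (symmetry group)] -/
private theorem map_rest
    (φ : ((Fin n × Fin n) → (Fin n × Fin n) → (Fin n × Fin n) → K) ≃ₗ[K]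
      ((Fin n × Fin n) → (Fin n × Fin n) → (Fin n × Fin n) → K))
    (f : Idx n ≃ Idx n) (hE : ∀ s, φ (E K n s) = E K n (f s)) {p q : Idx n} (hpq : p ≠ q) :
    (((Finset.univ.erase p).erase q).val.map (E K n)).map φ =
      ((Finset.univ.erase (f p)).erase (f q)).val.map (E K n) := by
  have h1 : (fam (W K n) (U K n) (V K n)).map φ = fam (W K n) (U K n) (V K n) := by
    rw [fam, Multiset.map_map]
    calc Finset.univ.val.map (φ ∘ fun s => triad (W K n s) (U K n s) (V K n s))
        = Finset.univ.val.map (E K n ∘ f) := Multiset.map_congr rfl fun s _ => hE s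
      _ = (Finset.univ.val.map f).map (E K n) := (Multiset.map_map _ _ _).symm
      _ = Finset.univ.val.map (E K n) := by rw [univ_val_map_equiv]
  have h2 : (E K n p ::ₘ E K n q ::ₘ ((Finset.univ.erase p).erase q).val.map (E K n)).map φ =
      E K n (f p) ::ₘ E K n (f q) ::ₘ ((Finset.univ.erase (f p)).erase (f q)).val.map (E K n) := by
    rw [← fam_std_eq_cons_cons hpq, h1, fam_std_eq_cons_cons (f.injective.ne hpq)]
  rw [Multiset.map_cons, Multiset.map_cons, hE, hE] at h2
  exact (Multiset.cons_inj_right _).1 ((Multiset.cons_inj_right _).1 h2)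

/-- … hence maps `{E_p + P, E_q − P} ∪ rest` to `{E_{fp} + φP, E_{fq} − φP} ∪ rest'`.
[cite: KauersMoosbauer2022FlipGraphs, §2 (symmetry group)] -/
private theorem map_nf
    (φ : ((Fin n × Fin n) → (Fin n × Fin n) → (Fin n × Fin n) → K) ≃ₗ[K]
      ((Fin n × Fin n) → (Fin n × Fin n) → (Fin n × Fin n) → K))
    (f : Idx n ≃ Idx n) (hE : ∀ s, φ (E K n s) = E K n (f s)) {p q : Idx n} (hpq : p ≠ q)
    (P : (Fin n × Fin n) → (Fin n × Fin n) → (Fin n × Fin n) → K) :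
    ((E K n p + P) ::ₘ (E K n q - P) ::ₘ ((Finset.univ.erase p).erase q).val.map (E K n)).map φ =
      (E K n (f p) + φ P) ::ₘ (E K n (f q) - φ P) ::ₘ
        ((Finset.univ.erase (f p)).erase (f q)).val.map (E K n) := by
  rw [Multiset.map_cons, Multiset.map_cons, _root_.map_add, _root_.map_sub, hE, hE,
    map_rest φ f hE hpq]

/-! ### Basis vectors under relabelling, transposition and diagonal scaling -/

omit [Field K] in
/-- `e_{ab} ∘ (π × ρ) = e_{π⁻¹a, ρ⁻¹b}`. [folklore] -/
private theorem single_comp_perm [Zero K] [One K] (π ρ : Equiv.Perm (Fin n)) (a b : Fin n)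
    (x : Fin n × Fin n) :
    (Pi.single (a, b) (1 : K) : Fin n × Fin n → K) (π x.1, ρ x.2) =
      (Pi.single (π.symm a, ρ.symm b) (1 : K) : Fin n × Fin n → K) x := by
  obtain ⟨x1, x2⟩ := x
  simp only [Pi.single_apply, Prod.mk.injEq, Equiv.apply_eq_iff_eq_symm_apply]

omit [Field K] in
/-- `e_{ab} ∘ swap = e_{ba}`. [folklore] -/
private theorem single_comp_swap [Zero K] [One K] (a b : Fin n) (x : Fin n × Fin n) :
    (Pi.single (a, b) (1 : K) : Fin n × Fin n → K) x.swap =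
      (Pi.single (b, a) (1 : K) : Fin n × Fin n → K) x := by
  obtain ⟨x1, x2⟩ := x
  simp only [Prod.swap_prod_mk, Pi.single_apply, Prod.mk.injEq]
  by_cases h1 : x1 = b <;> by_cases h2 : x2 = a <;> simp [h1, h2]

/-- Diagonal scalings of three basis vectors collect into one scalar. [folklore] -/
private theorem triad_diag_singles (f₁ f₂ f₃ : Fin n × Fin n → K) (i j k : Fin n × Fin n) :
    triad (fun a => f₁ a * (Pi.single i (1 : K) : Fin n × Fin n → K) a)
        (fun b => f₂ b * (Pi.single j (1 : K) : Fin n × Fin n → K) b)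
        (fun e => f₃ e * (Pi.single k (1 : K) : Fin n × Fin n → K) e) =
      (f₁ i * f₂ j * f₃ k) • triad (Pi.single i (1 : K) : Fin n × Fin n → K)
        (Pi.single j (1 : K)) (Pi.single k (1 : K)) := by
  funext a b e
  simp only [triad_apply, Pi.smul_apply, smul_eq_mul]
  by_cases ha : a = i
  · by_cases hb : b = j
    · by_cases he : e = k
      · subst ha hb he; simp
      · simp [Pi.single_eq_of_ne he]
    · simp [Pi.single_eq_of_ne hb]
  · simp [Pi.single_eq_of_ne ha]

/-! ### (a) The permutation sandwich moves the flipped pair -/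

/-- The index relabelling induced by `(P_π, P_σ, P_ρ)`. [cite: KauersMoosbauer2022FlipGraphs, §2] -/
def idxRelabel (π σ ρ : Equiv.Perm (Fin n)) : Idx n ≃ Idx n where
  toFun s := (π.symm s.1, σ.symm s.2.1, ρ.symm s.2.2)
  invFun s := (π s.1, σ s.2.1, ρ s.2.2)
  left_inv s := by simp
  right_inv s := by simp

/-- Its value. [cite: KauersMoosbauer2022FlipGraphs, §2] -/
@[simp] theorem idxRelabel_apply (π σ ρ : Equiv.Perm (Fin n)) (s : Idx n) :
    idxRelabel π σ ρ s = (π.symm s.1, σ.symm s.2.1, ρ.symm s.2.2) := rfl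

/-- The permutation sandwich permutes the standard products. [cite: KauersMoosbauer2022FlipGraphs, §2] -/
theorem relabelSym_E (π σ ρ : Equiv.Perm (Fin n)) (s : Idx n) :
    (relabelSym (K := K) π σ ρ).toLinearEquiv (E K n s) = E K n (idxRelabel π σ ρ s) := by
  rw [E, W, U, V, relabelSym_triad]
  simp only [single_comp_perm]
  rfl

/-- … and the wrong-index tensors alike. [cite: KauersMoosbauer2022FlipGraphs, §2] -/
theorem relabelSym_D (π σ ρ : Equiv.Perm (Fin n)) (p q : Idx n) :
    (relabelSym (K := K) π σ ρ).toLinearEquiv (D K n p q) =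
      D K n (idxRelabel π σ ρ p) (idxRelabel π σ ρ q) := by
  rw [D, W, U, V, relabelSym_triad]
  simp only [single_comp_perm]
  rfl

/-- **The permutation sandwich maps `N(p, q, c)` to `N(p̃, q̃, c)`.**
[cite: KauersMoosbauer2022FlipGraphs, §4 with §2 (symmetry group)] -/
theorem map_normalForm_relabelSym (π σ ρ : Equiv.Perm (Fin n)) {p q : Idx n} (hpq : p ≠ q)
    (c : K) : (normalForm K n p q c).map (relabelSym (K := K) π σ ρ).toLinearEquiv =
      normalForm K n (idxRelabel π σ ρ p) (idxRelabel π σ ρ q) c := by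
  rw [normalForm, map_nf _ (idxRelabel π σ ρ) (relabelSym_E π σ ρ) hpq, _root_.map_smul,
    relabelSym_D]
  rfl

/-- Two pairs of distinct points of `Fin n` are matched by a permutation. [folklore] -/
private theorem exists_perm_pair {m m₂ μ μ₂ : Fin n} (hm : m ≠ m₂) (hμ : μ ≠ μ₂) :
    ∃ τ : Equiv.Perm (Fin n), τ m = μ ∧ τ m₂ = μ₂ := by
  classical
  set τ₁ : Equiv.Perm (Fin n) := Equiv.swap m μ with hτ₁
  have h1 : τ₁ m = μ := Equiv.swap_apply_left _ _
  have ht : τ₁ m₂ ≠ μ := by rw [← h1]; exact fun e => hm.symm (τ₁.injective e)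
  refine ⟨τ₁.trans (Equiv.swap (τ₁ m₂) μ₂), ?_, ?_⟩
  · rw [Equiv.trans_apply, h1, Equiv.swap_apply_of_ne_of_ne (Ne.symm ht) hμ]
  · rw [Equiv.trans_apply, Equiv.swap_apply_left]

/-- **Any two admissible pairs `(p, q)` (distinct, same `Z`-factor) are matched by a permutation
sandwich.** [cite: KauersMoosbauer2022FlipGraphs, §4 with §2] -/
theorem exists_idxRelabel {p q p' q' : Idx n} (hpq : p ≠ q) (hW : W K n p = W K n q)
    (hpq' : p' ≠ q') (hW' : W K n p' = W K n q') :
    ∃ π σ ρ : Equiv.Perm (Fin n), idxRelabel π σ ρ p = p' ∧ idxRelabel π σ ρ q = q' := by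
  have e := zIdx_eq_of_prop (K := K) (t := p) (i := q) ⟨1, by rw [one_smul, hW]⟩
  have e' := zIdx_eq_of_prop (K := K) (t := p') (i := q') ⟨1, by rw [one_smul, hW']⟩
  obtain ⟨hκ, hν⟩ := Prod.mk.inj e
  obtain ⟨hκ', hν'⟩ := Prod.mk.inj e'
  have hμ : p.2.1 ≠ q.2.1 := fun h => hpq (Prod.ext hκ (Prod.ext h hν))
  have hμ' : p'.2.1 ≠ q'.2.1 := fun h => hpq' (Prod.ext hκ' (Prod.ext h hν'))
  obtain ⟨τ, hτ1, hτ2⟩ := exists_perm_pair hμ hμ'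
  refine ⟨Equiv.swap p'.1 p.1, τ.symm, Equiv.swap p'.2.2 p.2.2, ?_, ?_⟩
  · refine Prod.ext ?_ (Prod.ext ?_ ?_)
    · show (Equiv.swap p'.1 p.1).symm p.1 = p'.1
      rw [Equiv.symm_swap, Equiv.swap_apply_right]
    · show τ.symm.symm p.2.1 = p'.2.1
      rw [Equiv.symm_symm, hτ1]
    · show (Equiv.swap p'.2.2 p.2.2).symm p.2.2 = p'.2.2
      rw [Equiv.symm_swap, Equiv.swap_apply_right]
  · refine Prod.ext ?_ (Prod.ext ?_ ?_)
    · show (Equiv.swap p'.1 p.1).symm q.1 = q'.1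
      rw [Equiv.symm_swap, ← hκ, Equiv.swap_apply_right, hκ']
    · show τ.symm.symm q.2.1 = q'.2.1
      rw [Equiv.symm_symm, hτ2]
    · show (Equiv.swap p'.2.2 p.2.2).symm q.2.2 = q'.2.2
      rw [Equiv.symm_swap, ← hν, Equiv.swap_apply_right, hν']

/-! ### (b) A diagonal sandwich rescales the flip parameter -/

/-- A diagonal matrix with non-zero entries is invertible. [folklore] -/
private theorem isUnit_det_diagonal {d : Fin n → K} (hd : ∀ i, d i ≠ 0) :
    IsUnit (Matrix.diagonal d).det := by
  rw [Matrix.det_diagonal]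
  exact isUnit_iff_ne_zero.2 (Finset.prod_ne_zero_iff.2 fun i _ => hd i)

/-- **The diagonal sandwich `(diag dP, diag dQ, diag dR)`** — an element of KM's group `G`.
[cite: KauersMoosbauer2022FlipGraphs, §2 (symmetry group); Degroote1978, §3] -/
noncomputable def diagSym (dP dQ dR : Fin n → K) (hP : ∀ i, dP i ≠ 0) (hQ : ∀ i, dQ i ≠ 0)
    (hR : ∀ i, dR i ≠ 0) : Symmetry (matMulTensor K n n n) :=
  Symmetry.sandwich (Matrix.diagonal dP) (Matrix.diagonal dQ) (Matrix.diagonal dR)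
    (isUnit_det_diagonal hP) (isUnit_det_diagonal hQ) (isUnit_det_diagonal hR)

/-- It belongs to `G`. [cite: KauersMoosbauer2022FlipGraphs, §2 (symmetry group)] -/
theorem inSymmetryGroup_diagSym (dP dQ dR : Fin n → K) (hP : ∀ i, dP i ≠ 0)
    (hQ : ∀ i, dQ i ≠ 0) (hR : ∀ i, dR i ≠ 0) :
    InSymmetryGroup (diagSym dP dQ dR hP hQ hR) :=
  InSymmetryGroup.sandwich _ _ _ _ _ _

/-- The inverse of an invertible diagonal matrix. [folklore] -/
private theorem inv_diagonal' {d : Fin n → K} (hd : ∀ i, d i ≠ 0) :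
    (Matrix.diagonal d)⁻¹ = Matrix.diagonal fun i => (d i)⁻¹ := by
  refine Matrix.inv_eq_left_inv ?_
  rw [Matrix.diagonal_mul_diagonal, ← Matrix.diagonal_one]
  congr 1
  funext i
  exact inv_mul_cancel₀ (hd i)

/-- A Kronecker product of diagonal matrices acts diagonally. [folklore] -/
private theorem diagonal_kronecker_mulVec (a b : Fin n → K) (z : Fin n × Fin n → K) :
    (Matrix.diagonal a ⊗ₖ Matrix.diagonal b) *ᵥ z = fun x => a x.1 * b x.2 * z x := by
  rw [Matrix.diagonal_kronecker_diagonal]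
  funext x
  rw [Matrix.mulVec_diagonal]

/-- **The diagonal sandwich on rank-one tensors:** `z ⊗ x ⊗ y ↦ (dP⁻¹ z dR⁻¹) ⊗ (dP x dQ) ⊗ (dQ⁻¹ y dR)`
(entrywise row/column scalings). [cite: KauersMoosbauer2022FlipGraphs, §2 (symmetry group)] -/
theorem diagSym_triad (dP dQ dR : Fin n → K) (hP : ∀ i, dP i ≠ 0) (hQ : ∀ i, dQ i ≠ 0)
    (hR : ∀ i, dR i ≠ 0) (z x y : Fin n × Fin n → K) :
    (diagSym dP dQ dR hP hQ hR).toLinearEquiv (triad z x y) =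
      triad (fun a => (dP a.1)⁻¹ * (dR a.2)⁻¹ * z a) (fun b => dP b.1 * dQ b.2 * x b)
        (fun e => (dQ e.1)⁻¹ * dR e.2 * y e) := by
  show actTensor ((Matrix.diagonal dP)⁻¹ᵀ ⊗ₖ (Matrix.diagonal dR)⁻¹ᵀ)
      (Matrix.diagonal dP ⊗ₖ Matrix.diagonal dQ)
      ((Matrix.diagonal dQ)⁻¹ᵀ ⊗ₖ Matrix.diagonal dR) (triad z x y) = _
  rw [inv_diagonal' hP, inv_diagonal' hR, inv_diagonal' hQ, Matrix.diagonal_transpose,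
    Matrix.diagonal_transpose, Matrix.diagonal_transpose, actTensor_triad,
    diagonal_kronecker_mulVec, diagonal_kronecker_mulVec, diagonal_kronecker_mulVec]

/-- The diagonal sandwich fixes every standard product. [cite: KauersMoosbauer2022FlipGraphs, §2] -/
theorem diagSym_E (dP dQ dR : Fin n → K) (hP : ∀ i, dP i ≠ 0) (hQ : ∀ i, dQ i ≠ 0)
    (hR : ∀ i, dR i ≠ 0) (s : Idx n) :
    (diagSym dP dQ dR hP hQ hR).toLinearEquiv (E K n s) = E K n s := by
  rw [E, W, U, V, diagSym_triad, triad_diag_singles]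
  convert one_smul K _ using 2
  have := hP s.1; have := hQ s.2.1; have := hR s.2.2
  field_simp

/-- … and multiplies the wrong-index tensor `D(p, q)` by `dQ_μ / dQ_{μ'}` (for `dP = dR = 1`).
[cite: KauersMoosbauer2022FlipGraphs, §2] -/
theorem diagSym_D (dQ : Fin n → K) (hQ : ∀ i, dQ i ≠ 0) (p q : Idx n) :
    (diagSym (fun _ => (1 : K)) dQ (fun _ => 1) (fun _ => one_ne_zero) hQ
        (fun _ => one_ne_zero)).toLinearEquiv (D K n p q) =
      (dQ p.2.1 * (dQ q.2.1)⁻¹) • D K n p q := by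
  rw [D, W, U, V, diagSym_triad, triad_diag_singles]
  congr 1
  simp only [inv_one, one_mul, mul_one]

/-- **The diagonal sandwich `dQ = (1, …, c, …, 1)` (a `c` at the inner index of `q`) maps
`N(p, q, c)` to `N(p, q, 1)`.** [cite: KauersMoosbauer2022FlipGraphs, §4 with §2] -/
theorem exists_map_normalForm_eq_one {p q : Idx n} (hpq : p ≠ q) (hW : W K n p = W K n q)
    {c : K} (hc : c ≠ 0) :
    ∃ φ : Symmetry (matMulTensor K n n n), InSymmetryGroup φ ∧
      (normalForm K n p q c).map φ.toLinearEquiv = normalForm K n p q 1 := by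
  obtain ⟨hκ, hν⟩ := Prod.mk.inj (zIdx_eq_of_prop (K := K) (t := p) (i := q) ⟨1, by rw [one_smul, hW]⟩)
  have hμ : p.2.1 ≠ q.2.1 := fun h => hpq (Prod.ext hκ (Prod.ext h hν))
  set dQ : Fin n → K := fun i => if i = q.2.1 then c else 1 with hdQ
  have hQ : ∀ i, dQ i ≠ 0 := fun i => by
    by_cases h : i = q.2.1
    · simp only [hdQ, h, if_true]; exact hc
    · simp only [hdQ, h, if_false]; exact one_ne_zero
  refine ⟨diagSym (fun _ => 1) dQ (fun _ => 1) (fun _ => one_ne_zero) hQ (fun _ => one_ne_zero),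
    inSymmetryGroup_diagSym _ _ _ _ _ _, ?_⟩
  rw [normalForm, map_nf _ (Equiv.refl _) (fun s => diagSym_E _ _ _ _ _ _ s) hpq,
    _root_.map_smul, diagSym_D, smul_smul, normalForm]
  have hc' : c * (dQ p.2.1 * (dQ q.2.1)⁻¹) = 1 := by
    simp only [hdQ, if_neg hμ, if_pos rfl, one_mul]
    exact mul_inv_cancel₀ hc
  rw [hc']
  rfl

/-! ### (c) The cyclic shift carries slot `Z` to slots `Y` and `X` -/

/-- The index rotation induced by the cyclic shift: `(κ,μ,ν) ↦ (μ,ν,κ)`. [cite: KauersMoosbauer2022FlipGraphs, §2] -/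
def idxCyc : Idx n ≃ Idx n :=
  (Equiv.prodComm (Fin n) (Fin n × Fin n)).trans (Equiv.prodAssoc (Fin n) (Fin n) (Fin n))

/-- Its value. [cite: KauersMoosbauer2022FlipGraphs, §2] -/
@[simp] theorem idxCyc_apply (s : Idx n) : idxCyc s = (s.2.1, s.2.2, s.1) := rfl

/-- The cyclic shift permutes the standard products: `E_{κμν} ↦ E_{μνκ}`.
[cite: KauersMoosbauer2022FlipGraphs, §2 (symmetry group)] -/
theorem cycleSq_E (s : Idx n) :
    (Symmetry.cycleSq (K := K) n).toLinearEquiv (E K n s) = E K n (idxCyc s) := by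
  rw [E, W, U, V, cycleSq_triad]
  simp only [single_comp_swap]
  rfl

/-- The cyclic shift on the wrong-index tensor of a `Z`-flip (same `Z`-factor `W p = W q`):
`D(p, q) ↦ D₃(q̃, p̃)`. [cite: KauersMoosbauer2022FlipGraphs, §2 (symmetry group)] -/
theorem cycleSq_D {p q : Idx n} (hW : W K n p = W K n q) :
    (Symmetry.cycleSq (K := K) n).toLinearEquiv (D K n p q) = D₃ K n (idxCyc q) (idxCyc p) := by
  obtain ⟨hκ, hν⟩ := Prod.mk.inj (zIdx_eq_of_prop (K := K) (t := p) (i := q) ⟨1, by rw [one_smul, hW]⟩)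
  rw [D, W, U, V, cycleSq_triad]
  simp only [single_comp_swap]
  rw [D₃, W, U, V, idxCyc_apply, idxCyc_apply, hκ, hν]

/-- The cyclic shift on the wrong-index tensor of a `Y`-flip: `D₃(P, Q) ↦ D(P̃, Q̃)`.
[cite: KauersMoosbauer2022FlipGraphs, §2 (symmetry group)] -/
theorem cycleSq_D₃ (P Q : Idx n) :
    (Symmetry.cycleSq (K := K) n).toLinearEquiv (D₃ K n P Q) = D K n (idxCyc P) (idxCyc Q) := by
  rw [D₃, W, U, V, cycleSq_triad]
  simp only [single_comp_swap]
  rfl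

/-- **The cyclic shift maps the `Z`-flip `N(p, q, c)` to the `Y`-flip `N₃(q̃, p̃, −c)`.**
[cite: KauersMoosbauer2022FlipGraphs, §4 with §2] -/
theorem map_normalForm_cycleSq {p q : Idx n} (hpq : p ≠ q) (hW : W K n p = W K n q) (c : K) :
    (normalForm K n p q c).map (Symmetry.cycleSq (K := K) n).toLinearEquiv =
      normalForm₃ K n (idxCyc q) (idxCyc p) (-c) := by
  rw [normalForm, map_nf _ idxCyc cycleSq_E hpq, _root_.map_smul, cycleSq_D hW, normalForm₃,
    neg_smul,
    ← sub_eq_add_neg, sub_neg_eq_add, Multiset.cons_swap, Finset.erase_right_comm]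

/-- **The cyclic shift maps the `Y`-flip `N₃(P, Q, c)` to the `X`-flip `N(P̃, Q̃, c)`.**
[cite: KauersMoosbauer2022FlipGraphs, §4 with §2] -/
theorem map_normalForm₃_cycleSq {P Q : Idx n} (hPQ : P ≠ Q) (c : K) :
    (normalForm₃ K n P Q c).map (Symmetry.cycleSq (K := K) n).toLinearEquiv =
      normalForm K n (idxCyc P) (idxCyc Q) c := by
  rw [normalForm₃, map_nf _ idxCyc cycleSq_E hPQ, _root_.map_smul, cycleSq_D₃, normalForm]

/-! ### (d) Assembly: every flip of the standard algorithm is `G`-equivalent to every other -/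

/-- Undoing a symmetry on a multiset. [folklore] -/
private theorem map_map_symm (φ : Symmetry (matMulTensor K n n n))
    (M : Multiset ((Fin n × Fin n) → (Fin n × Fin n) → (Fin n × Fin n) → K)) :
    (M.map φ.toLinearEquiv).map φ.symm.toLinearEquiv = M := by
  rw [Multiset.map_map]
  refine (Multiset.map_congr rfl fun T _ => ?_).trans (Multiset.map_id' M)
  exact φ.toLinearEquiv.symm_apply_apply T

/-- Composing symmetries on a multiset. [folklore] -/
private theorem map_map_trans (φ ψ : Symmetry (matMulTensor K n n n))
    (M : Multiset ((Fin n × Fin n) → (Fin n × Fin n) → (Fin n × Fin n) → K)) :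
    (M.map φ.toLinearEquiv).map ψ.toLinearEquiv = M.map (φ.trans ψ).toLinearEquiv := by
  rw [Multiset.map_map]; rfl

/-- Every `Z`-flip `N(p, q, c)` is a `G`-image of `N(p, q, 1)`. [cite: KauersMoosbauer2022FlipGraphs, §4] -/
theorem exists_normalForm_eq_map_one {p q : Idx n} (hpq : p ≠ q) (hW : W K n p = W K n q)
    {c : K} (hc : c ≠ 0) :
    ∃ φ : Symmetry (matMulTensor K n n n), InSymmetryGroup φ ∧
      normalForm K n p q c = (normalForm K n p q 1).map φ.toLinearEquiv := by
  obtain ⟨φ, hφ, h⟩ := exists_map_normalForm_eq_one hpq hW hc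
  exact ⟨φ.symm, hφ.symm, by rw [← h, map_map_symm]⟩

/-- Every `Y`-flip `N₃(P, Q, c)` is a `G`-image of some `Z`-flip `N(p, q, 1)`.
[cite: KauersMoosbauer2022FlipGraphs, §4] -/
theorem exists_normalForm₃_eq_map {P Q : Idx n} (hPQ : P ≠ Q) (hV : V K n P = V K n Q)
    {c : K} (hc : c ≠ 0) :
    ∃ (p q : Idx n), p ≠ q ∧ W K n p = W K n q ∧
      ∃ φ : Symmetry (matMulTensor K n n n), InSymmetryGroup φ ∧
        normalForm₃ K n P Q c = (normalForm K n p q 1).map φ.toLinearEquiv := by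
  obtain ⟨hμ, hν⟩ := Prod.mk.inj (yIdx_eq_of_prop (K := K) (t := P) (i := Q) ⟨1, by rw [one_smul, hV]⟩)
  have hpq : idxCyc.symm Q ≠ idxCyc.symm P := fun h => hPQ (idxCyc.symm.injective h).symm
  have hW : W K n (idxCyc.symm Q) = W K n (idxCyc.symm P) := by
    show (Pi.single (Q.2.2, Q.2.1) (1 : K) : Fin n × Fin n → K) = Pi.single (P.2.2, P.2.1) (1 : K)
    rw [hμ, hν]
  obtain ⟨φ, hφ, h1⟩ := exists_normalForm_eq_map_one hpq hW (neg_ne_zero.2 hc)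
  refine ⟨_, _, hpq, hW, φ.trans (Symmetry.cycleSq n), hφ.trans InSymmetryGroup.cycle, ?_⟩
  rw [← map_map_trans, ← h1, map_normalForm_cycleSq hpq hW, Equiv.apply_symm_apply,
    Equiv.apply_symm_apply, neg_neg]

/-- Every `X`-flip `N(P, Q, c)`, `U P = U Q`, is a `G`-image of some `Z`-flip `N(p, q, 1)`.
[cite: KauersMoosbauer2022FlipGraphs, §4] -/
theorem exists_normalForm₂_eq_map {P Q : Idx n} (hPQ : P ≠ Q) (hU : U K n P = U K n Q)
    {c : K} (hc : c ≠ 0) :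
    ∃ (p q : Idx n), p ≠ q ∧ W K n p = W K n q ∧
      ∃ φ : Symmetry (matMulTensor K n n n), InSymmetryGroup φ ∧
        normalForm K n P Q c = (normalForm K n p q 1).map φ.toLinearEquiv := by
  obtain ⟨hκ, hμ⟩ := Prod.mk.inj (xIdx_eq_of_prop (K := K) (t := P) (i := Q) ⟨1, by rw [one_smul, hU]⟩)
  have hPQ' : idxCyc.symm P ≠ idxCyc.symm Q := fun h => hPQ (idxCyc.symm.injective h)
  have hV : V K n (idxCyc.symm P) = V K n (idxCyc.symm Q) := by
    show (Pi.single (P.1, P.2.1) (1 : K) : Fin n × Fin n → K) = Pi.single (Q.1, Q.2.1) (1 : K)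
    rw [hκ, hμ]
  obtain ⟨p, q, hpq, hW, φ, hφ, h1⟩ := exists_normalForm₃_eq_map hPQ' hV hc
  refine ⟨p, q, hpq, hW, φ.trans (Symmetry.cycleSq n), hφ.trans InSymmetryGroup.cycle, ?_⟩
  rw [← map_map_trans, ← h1, map_normalForm₃_cycleSq hPQ', Equiv.apply_symm_apply,
    Equiv.apply_symm_apply]

/-- **Every flip of the standard algorithm is a `G`-image of a `Z`-flip `N(p, q, 1)`.**
[cite: KauersMoosbauer2022FlipGraphs, §4] -/
theorem exists_eq_map_normalForm_of_flips
    {S' : Multiset ((Fin n × Fin n) → (Fin n × Fin n) → (Fin n × Fin n) → K)}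
    (h : Flips (fam (W K n) (U K n) (V K n)) S') :
    ∃ (p q : Idx n), p ≠ q ∧ W K n p = W K n q ∧
      ∃ φ : Symmetry (matMulTensor K n n n), InSymmetryGroup φ ∧
        S' = (normalForm K n p q 1).map φ.toLinearEquiv := by
  rcases flips_std_cases h with ⟨p, q, c, hpq, hW, hc, rfl⟩ | ⟨P, Q, c, hPQ, hU, hc, rfl⟩ |
    ⟨P, Q, c, hPQ, hV, hc, rfl⟩
  · exact ⟨p, q, hpq, hW, exists_normalForm_eq_map_one hpq hW hc⟩
  · exact exists_normalForm₂_eq_map hPQ hU hc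
  · exact exists_normalForm₃_eq_map hPQ hV hc

/-- **Any two `Z`-flips `N(p, q, 1)`, `N(p', q', 1)` are `G`-equivalent** (a permutation sandwich).
[cite: KauersMoosbauer2022FlipGraphs, §4] -/
theorem exists_normalForm_eq_map_normalForm {p q p' q' : Idx n} (hpq : p ≠ q)
    (hW : W K n p = W K n q) (hpq' : p' ≠ q') (hW' : W K n p' = W K n q') (c : K) :
    ∃ φ : Symmetry (matMulTensor K n n n), InSymmetryGroup φ ∧
      normalForm K n p' q' c = (normalForm K n p q c).map φ.toLinearEquiv := by
  obtain ⟨π, σ, ρ, hp, hq⟩ := exists_idxRelabel (K := K) hpq hW hpq' hW'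
  exact ⟨relabelSym π σ ρ, inSymmetryGroup_relabelSym π σ ρ,
    by rw [map_normalForm_relabelSym π σ ρ hpq, hp, hq]⟩

/-- Two schemes with the same elements are equal (bookkeeping). [folklore] -/
private theorem scheme_ext' {t : (Fin n × Fin n) → (Fin n × Fin n) → (Fin n × Fin n) → K}
    {x y : Scheme t} (h : x.elts = y.elts) : x = y := by
  cases x; cases y; cases h; rfl

/-- **KM §4, over every field and for every `n`: "any two schemes obtained by a flip from the
standard algorithm are equivalent"** — indeed any two neighbours (Def. 8: flips or reductions; the
standard algorithm admits no reduction) of the standard algorithm of `⟨n,n,n⟩` lie in one orbit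
of KM's symmetry group `G`. [cite: KauersMoosbauer2022FlipGraphs, §4] -/
theorem std_neighbours_equivalent {y y' : Scheme (matMulTensor K n n n)}
    (h : Adj (stdScheme (matMulTensor K n n n)) y)
    (h' : Adj (stdScheme (matMulTensor K n n n)) y') : (orbitSetoidKM K n).r y y' := by
  have hy := flips_of_adj_std h
  have hy' := flips_of_adj_std h'
  rw [stdScheme_elts] at hy hy'
  obtain ⟨p, q, hpq, hW, φ, hφ, e⟩ := exists_eq_map_normalForm_of_flips hy
  obtain ⟨p', q', hpq', hW', φ', hφ', e'⟩ := exists_eq_map_normalForm_of_flips hy'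
  obtain ⟨ψ, hψ, eψ⟩ := exists_normalForm_eq_map_normalForm hpq hW hpq' hW' (1 : K)
  refine ⟨(φ.symm.trans ψ).trans φ', (hφ.symm.trans hψ).trans hφ', scheme_ext' ?_⟩
  rw [Scheme.map_elts, ← map_map_trans, ← map_map_trans, e, map_map_symm, ← eψ, ← e']

/-- **KM §4: "the standard algorithm … only has one neighbor"** — in KM's flip graph on orbits
(Def. 8), over every field and for every `n`, all out-neighbours of the orbit of the standard
algorithm coincide. [cite: KauersMoosbauer2022FlipGraphs, §4, Def. 8] -/
theorem std_one_neighbour (q q' : Quotient (orbitSetoidKM K n))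
    (hq : flipGraphKM K n (Quotient.mk _ (stdScheme (matMulTensor K n n n))) q)
    (hq' : flipGraphKM K n (Quotient.mk _ (stdScheme (matMulTensor K n n n))) q') : q = q' := by
  induction q using Quotient.inductionOn with
  | h y =>
    induction q' using Quotient.inductionOn with
    | h y' =>
      rw [flipGraphKM_mk_iff] at hq hq'
      obtain ⟨z, hyz, hz⟩ := hq
      obtain ⟨z', hyz', hz'⟩ := hq'
      exact Quotient.sound ((orbitSetoidKM K n).iseqv.trans hyz
        ((orbitSetoidKM K n).iseqv.trans (std_neighbours_equivalent hz hz')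
          ((orbitSetoidKM K n).iseqv.symm hyz')))

end StdFlips

/-- **KM 2023 §4 for `⟨n,n,n⟩` over an arbitrary field `K` and every `n`:** any two neighbours of
the standard algorithm in the flip graph (Def. 8) are equivalent under KM's symmetry group — "it
only has one neighbor, because any two schemes obtained by a flip from the standard algorithm
are equivalent". [cite: KauersMoosbauer2022FlipGraphs, §4] -/
theorem kauersMoosbauer2023_std_neighbours_equivalent (K : Type*) [Field K] (n : ℕ)
    {y y' : FlipGraph.Scheme (matMulTensor K n n n)}
    (h : FlipGraph.Adj (FlipGraph.stdScheme (matMulTensor K n n n)) y)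
    (h' : FlipGraph.Adj (FlipGraph.stdScheme (matMulTensor K n n n)) y') :
    (FlipGraph.orbitSetoidKM K n).r y y' :=
  StdFlips.std_neighbours_equivalent h h'

/-! ## §5 The neighbour exists iff `n ≥ 2`: the standard algorithm has exactly one neighbour -/

namespace StdFlips

open FlipGraph

variable {K : Type*} [Field K] {n : ℕ}

/-- `a ⊗ b ⊗ (c + r·c') = a⊗b⊗c + r·(a⊗b⊗c')`. [folklore] -/
private theorem triad_add_smul₃ (a b c c' : Fin n × Fin n → K) (r : K) :
    triad a b (c + r • c') = triad a b c + r • triad a b c' := by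
  funext x y z
  simp only [triad_apply, Pi.add_apply, Pi.smul_apply, smul_eq_mul]
  ring

/-- `a ⊗ (b − r·b') ⊗ c = a⊗b⊗c − r·(a⊗b'⊗c)`. [folklore] -/
private theorem triad_sub_smul₂ (a b b' c : Fin n × Fin n → K) (r : K) :
    triad a (b - r • b') c = triad a b c - r • triad a b' c := by
  funext x y z
  simp only [triad_apply, Pi.sub_apply, Pi.smul_apply, smul_eq_mul]
  ring

/-- In an admissible pair the inner indices differ. [cite: KauersMoosbauer2022FlipGraphs, Def. 4] -/
theorem inner_ne {p q : Idx n} (hpq : p ≠ q) (hW : W K n p = W K n q) : p.2.1 ≠ q.2.1 := by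
  obtain ⟨hκ, hν⟩ := Prod.mk.inj (zIdx_eq_of_prop (K := K) (t := p) (i := q) ⟨1, by rw [one_smul, hW]⟩)
  exact fun h => hpq (Prod.ext hκ (Prod.ext h hν))

/-- The two new elements of `N(p, q, c)` are non-zero (value `1` at their own position).
[cite: KauersMoosbauer2022FlipGraphs, Def. 1, Def. 4] -/
theorem normalForm_new_ne_zero {p q : Idx n} (hpq : p ≠ q) (hW : W K n p = W K n q) (c : K) :
    E K n p + c • D K n p q ≠ 0 ∧ E K n q - c • D K n p q ≠ 0 := by
  have hμ := inner_ne hpq hW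
  obtain ⟨hκ, hν⟩ := Prod.mk.inj (zIdx_eq_of_prop (K := K) (t := p) (i := q) ⟨1, by rw [one_smul, hW]⟩)
  constructor
  · intro h
    have e := congrFun (congrFun (congrFun h (p.1, p.2.2)) (p.1, p.2.1)) (p.2.1, p.2.2)
    rw [Pi.add_apply, Pi.add_apply, Pi.add_apply, E_apply_self, Pi.smul_apply, Pi.smul_apply,
      Pi.smul_apply, smul_eq_mul, D, triad_apply, V,
      Pi.single_eq_of_ne (show (p.2.1, p.2.2) ≠ (q.2.1, q.2.2) from fun e => hμ (Prod.mk.inj e).1),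
      mul_zero, mul_zero, add_zero, Pi.zero_apply] at e
    exact one_ne_zero e
  · intro h
    have e := congrFun (congrFun (congrFun h (q.1, q.2.2)) (q.1, q.2.1)) (q.2.1, q.2.2)
    rw [Pi.sub_apply, Pi.sub_apply, Pi.sub_apply, E_apply_self, Pi.smul_apply, Pi.smul_apply,
      Pi.smul_apply, smul_eq_mul, D, triad_apply, U,
      Pi.single_eq_of_ne (show (q.1, q.2.1) ≠ (p.1, p.2.1) from fun e => hμ (Prod.mk.inj e).2.symm),
      mul_zero, zero_mul, mul_zero, sub_zero, Pi.zero_apply] at e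
    exact one_ne_zero e

/-- The two new elements of `N(p, q, c)` are rank-one tensors: `E_p + cD = e_{κν}⊗e_{κμ}⊗(e_{μν} +
c e_{μ'ν})`, `E_q − cD = e_{κν}⊗(e_{κμ'} − c e_{κμ})⊗e_{μ'ν}`. [cite: KauersMoosbauer2022FlipGraphs, Def. 4] -/
theorem normalForm_new_eq_triad (p q : Idx n) (hW : W K n p = W K n q) (c : K) :
    E K n p + c • D K n p q = triad (W K n p) (U K n p) (V K n p + c • V K n q) ∧
    E K n q - c • D K n p q = triad (W K n q) (U K n q - c • U K n p) (V K n q) := by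
  refine ⟨by rw [triad_add_smul₃]; rfl, by rw [triad_sub_smul₂, E, D, hW]⟩

/-- **The flip `N(p, q, c)` of the standard algorithm as a scheme of `⟨n,n,n⟩`** (Def. 1: non-zero
rank-one tensors summing to `⟨n,n,n⟩` — a flip keeps the sum). [cite: KauersMoosbauer2022FlipGraphs, Def. 4, Def. 1] -/
def nfScheme {p q : Idx n} (hpq : p ≠ q) (hW : W K n p = W K n q) {c : K} (hc : c ≠ 0) :
    Scheme (matMulTensor K n n n) where
  elts := normalForm K n p q c
  ne_zero T hT := by
    rcases Multiset.mem_cons.1 hT with rfl | hT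
    · exact (normalForm_new_ne_zero hpq hW c).1
    rcases Multiset.mem_cons.1 hT with rfl | hT
    · exact (normalForm_new_ne_zero hpq hW c).2
    obtain ⟨s, -, rfl⟩ := Multiset.mem_map.1 hT
    exact E_ne_zero s
  exists_triad T hT := by
    rcases Multiset.mem_cons.1 hT with rfl | hT
    · exact ⟨_, _, _, (normalForm_new_eq_triad p q hW c).1⟩
    rcases Multiset.mem_cons.1 hT with rfl | hT
    · exact ⟨_, _, _, (normalForm_new_eq_triad p q hW c).2⟩
    obtain ⟨s, -, rfl⟩ := Multiset.mem_map.1 hT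
    exact ⟨_, _, _, rfl⟩
  sum_eq := by
    rw [(flipBase_normalForm hpq hW hc).sum_eq, ← stdScheme_elts]
    exact (stdScheme _).sum_eq

/-- Its elements. [cite: KauersMoosbauer2022FlipGraphs, Def. 4] -/
theorem nfScheme_elts {p q : Idx n} (hpq : p ≠ q) (hW : W K n p = W K n q) {c : K} (hc : c ≠ 0) :
    (nfScheme hpq hW hc).elts = normalForm K n p q c := rfl

/-- **`N(p, q, c)` is a neighbour of the standard algorithm** (an `E₁` edge, Def. 8).
[cite: KauersMoosbauer2022FlipGraphs, §4, Def. 8] -/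
theorem adj_std_nfScheme {p q : Idx n} (hpq : p ≠ q) (hW : W K n p = W K n q) {c : K}
    (hc : c ≠ 0) : Adj (stdScheme (matMulTensor K n n n)) (nfScheme hpq hW hc) := by
  refine Or.inl (Or.inl ?_)
  rw [stdScheme_elts]
  exact flipBase_normalForm hpq hW hc

/-- Its rank is `n³` (a flip keeps the level). [cite: KauersMoosbauer2022FlipGraphs, §4, Def. 8] -/
theorem rank_nfScheme {p q : Idx n} (hpq : p ≠ q) (hW : W K n p = W K n q) {c : K} (hc : c ≠ 0) :
    (nfScheme hpq hW hc).rank = n * n * n := by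
  rw [Scheme.rank, nfScheme_elts, (flipBase_normalForm hpq hW hc).card_eq, ← stdScheme_elts]
  exact rank_stdScheme_matMulTensor n n n

/-- **For `n ≥ 2` the standard algorithm has a neighbour** (e.g. `N((0,0,0), (0,1,0), 1)`).
[cite: KauersMoosbauer2022FlipGraphs, §4] -/
theorem exists_adj_std (hn : 2 ≤ n) :
    ∃ y : Scheme (matMulTensor K n n n), Adj (stdScheme (matMulTensor K n n n)) y := by
  have h0 : 0 < n := by omega
  have h1 : 1 < n := by omega
  have hpq : ((⟨0, h0⟩, ⟨0, h0⟩, ⟨0, h0⟩) : Idx n) ≠ (⟨0, h0⟩, ⟨1, h1⟩, ⟨0, h0⟩) := by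
    intro e
    have e' := congrArg (fun s : Idx n => (s.2.1 : ℕ)) e
    exact absurd e' (by norm_num)
  exact ⟨nfScheme hpq rfl one_ne_zero, adj_std_nfScheme hpq rfl (one_ne_zero (α := K))⟩

/-- **For `n ≤ 1` the standard algorithm has no neighbour at all** (no two products share a
factor; it is irreducible). [cite: KauersMoosbauer2022FlipGraphs, §4, Def. 8] -/
theorem not_adj_std_of_le_one (hn : n ≤ 1) (y : Scheme (matMulTensor K n n n)) :
    ¬ Adj (stdScheme (matMulTensor K n n n)) y := by
  intro h
  have hy := flips_of_adj_std h
  rw [stdScheme_elts] at hy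
  obtain ⟨p, q, hpq, -, -⟩ := exists_eq_map_normalForm_of_flips hy
  have : Subsingleton (Fin n) := by
    rcases Nat.le_one_iff_eq_zero_or_eq_one.1 hn with rfl | rfl <;> infer_instance
  exact hpq (Subsingleton.elim p q)

/-- **KM §4 "the standard algorithm … only has one neighbor", sharp form over every field:** for
`n ≥ 2` the orbit of the standard algorithm of `⟨n,n,n⟩` has exactly one out-neighbour in KM's
flip graph on orbits (Def. 8). [cite: KauersMoosbauer2022FlipGraphs, §4, Def. 8] -/
theorem std_existsUnique_neighbour (hn : 2 ≤ n) :
    ∃! q : Quotient (orbitSetoidKM K n),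
      flipGraphKM K n (Quotient.mk _ (stdScheme (matMulTensor K n n n))) q := by
  obtain ⟨y, hy⟩ := exists_adj_std (K := K) hn
  refine ⟨Quotient.mk _ y, (flipGraphKM_mk_iff _ _).2 ⟨y, (orbitSetoidKM K n).iseqv.refl y, hy⟩,
    fun q hq => std_one_neighbour q _ hq ?_⟩
  exact (flipGraphKM_mk_iff _ _).2 ⟨y, (orbitSetoidKM K n).iseqv.refl y, hy⟩

/-- … and for `n ≤ 1` it has none. [cite: KauersMoosbauer2022FlipGraphs, §4, Def. 8] -/
theorem std_no_neighbour_of_le_one (hn : n ≤ 1) (q : Quotient (orbitSetoidKM K n)) :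
    ¬ flipGraphKM K n (Quotient.mk _ (stdScheme (matMulTensor K n n n))) q := by
  induction q using Quotient.inductionOn with
  | h y =>
    rw [flipGraphKM_mk_iff]
    rintro ⟨y', -, hy'⟩
    exact not_adj_std_of_le_one hn y' hy'

end StdFlips

/-- **KM 2023 §4, sharp form for `⟨n,n,n⟩` over an arbitrary field:** for every `n ≥ 2` the
standard algorithm has exactly one neighbour in the flip graph on `G`-orbits (Def. 8).
[cite: KauersMoosbauer2022FlipGraphs, §4] -/
theorem kauersMoosbauer2023_std_existsUnique_neighbour (K : Type*) [Field K] {n : ℕ} (hn : 2 ≤ n) :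
    ∃! q : Quotient (FlipGraph.orbitSetoidKM K n),
      FlipGraph.flipGraphKM K n
        (Quotient.mk _ (FlipGraph.stdScheme (matMulTensor K n n n))) q :=
  StdFlips.std_existsUnique_neighbour hn

end Literature.Computability.AlgebraicComplexity
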